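import Literature.Barriers.ValiantsHypothesis.GKKP11CharacteristicTwo
import Literature.Computability.AlgebraicComplexity.SymmDeterminantalComplexity
import Literature.LinearAlgebra.Matrix.PfaffianDeterminant
import Literature.Computability.AlgebraicComplexity.DeterminantalComplexityProofs
import HarnessLib

/-!
# No symmetric determinantal representation for `xy + z` in characteristic 2
(Grenet–Monteil–Thomassé 2013: Def. 1.1, Prop. 2.1, Lemma 3.1, Def. 4.1, Thm. 4.2 with Lemmas
4.4–4.8, §4.2, Thm. 6.1) — typed literature, everything PROVED, no named facts

B. Grenet, T. Monteil, S. Thomassé, *Symmetric determinantal representations in characteristic 2*,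
Linear Algebra Appl. **439** (2013) 1364–1381 = arXiv:1210.5879 (held text
`paper:arxiv-1210.5879`, pages `p0003`–`p0016`; locators below are to those pages).
Cell `val-lit`, typer t16 (g6), EXTENDING DAG row `GKKP11-B`: the companion file
`Literature.Barriers.ValiantsHypothesis.GKKP11CharacteristicTwo` (GKKP 2011 §5) lists "the [GMT]
non-representability of `xy + z`" as quoted-not-typed, and the definition file
`Literature.Computability.AlgebraicComplexity.SymmDeterminantalComplexity` quotes GKKP 2011 §1.1:
"For fields of characteristic `2`, it can be shown that some polynomials (such as e.g. the
polynomial `xy + z`) cannot be represented as determinants of symmetric matrices [GMT]. Note as a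
result that the 2-dimensional permanent `xw + yz` cannot be 'symmetrized' over characteristic `2`
with any dimension" — both sentences are THEOREMS here (`not_hasSymmDetRepr_X_mul_X_add_X`,
`not_hasSymmDetRepr_perPoly_two`), over EVERY field of characteristic `2`.
Honest framing: this is an obstruction to the symmetric-determinant MODEL in characteristic `2`
(where the symmetrization constructions of GKKP §§2–4 need `1/2`); it says nothing about `dc`,
and `VP ≠ VNP` is NOT proved — nothing here is progress on it.

## What the source prints and how it is rendered

* **Definition 1.1 (p0003).** "A polynomial `P ∈ F[x_1,…,x_m]` is said *representable* if it has
  an SDR, that is if there exists a symmetric matrix `M` with entries in `F ∪ {x_1,…,x_m}` such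
  that `P = det(M)`." = `Representable P` (entries constants or variables:
  `HasScalarOrVarEntries`; any size). The source adds (p0003): "One can also find in the literature
  other definitions where … the symmetric matrix has linear (degree-1) polynomials as entries. The
  two definitions are essentially equivalent". The tree's notion
  `Literature.Computability.AlgebraicComplexity.HasSymmDetRepr f N` (symmetric `N × N` matrix of
  AFFINE linear forms) is the second one; `Representable.exists_hasSymmDetRepr` is the trivial
  direction, and all non-existence results below are proved for the (weaker-to-refute, hence
  stronger) affine notion and then specialised.
* **Example (p0003).** "`xy + yz + zx` is representable as the determinant of the `4 × 4` matrix
  `[[x,0,0,1],[0,y,0,1],[0,0,z,1],[1,1,1,0]]`" = `representable_example` (PROVED; the printed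
  matrix has determinant `−(xy + yz + zx)`, which is the claim in characteristic `2`).
* **Proposition 2.1 (p0004).** In characteristic `2` the determinant of a symmetric matrix is the
  sum over INVOLUTIONS `σ` of `∏ᵢ M_{i,σ(i)}` = GKKP 2011 Lemma 6 = the tree's
  `Matrix.det_eq_sum_involutive_of_charTwo` — CITED and used, not restated.
* **§2.2 (p0004).** `𝓘(ℓ) = ⟨x_1² + ℓ_1, …, x_m² + ℓ_m⟩` = `sqIdeal F σ ℓ`; `R(ℓ) = F[x]/𝓘(ℓ)`; we
  work in `R(0̄) = SqZero F σ` (the paper's `𝓘_0` of §5.1), where the "absolute value" `|r|`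
  (the constant with `r² = |r|²`) is the evaluation at `0` (`absZero`, `mul_self_eq_absZero`:
  "The square of any element of `R(ℓ)` belongs to `F`"), and the "linear elements" (projections of
  polynomials of degree `≤ 1`) are the span `linElems` of `1, x̄_v`.
* **Lemma 3.1 (p0005).** "Let `P` and `Q` be two representable polynomials. Then `P × Q` is
  representable." = `Representable.mul` (PROVED, block-diagonal matrix as printed).
* **Definition 4.1 (p0007).** "`P` is said factorizable modulo `R(ℓ)` if there exist some linear
  elements `t_1,…,t_k` of `R(ℓ)` such that `π_ℓ(P) = t_1 × ⋯ × t_k`. This definition can be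
  restated as follows. … if there exists some linear polynomials `L_1,…,L_k` of `F[x_1,…,x_m]` such
  that `π_ℓ(P) = π_ℓ(L_1 ⋯ L_k)`." = `IsLinFactorizableMod ℓ P`, rendered with explicit data:
  `P = ∏ⱼ (a_j + Σ_v b_{jv} x_v) + Σ_v q_v · (x_v² + ℓ_v)`; `isLinFactorizableMod_iff` is the
  printed form (`P − ∏ L_j ∈ 𝓘(ℓ)` with `deg L_j ≤ 1`).
* **Theorem 4.2 (p0007).** "Let `P ∈ F[x_1,…,x_m]` be a representable polynomial. Then for every
  tuple of squares `ℓ² ∈ F^m`, `P` is factorizable modulo `R(ℓ²)`." =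
  `Representable.isLinFactorizableMod_sq` (PROVED), via the stronger
  `det_isLinFactorizableMod_sq`: the conclusion holds for `det M` whenever `M` is symmetric
  with DIAGONAL entries of degree `≤ 1` (off-diagonal entries arbitrary polynomials; this covers
  GMT's gSDRs of Def. 3.4 after projection, Lemma 4.4, and the tree's affine notion:
  `isLinFactorizableMod_sq_of_hasSymmDetRepr`). **Proof as printed (§4.1,
  p0007–p0009)**, run over an abstract commutative `F`-algebra `𝒜` of characteristic `2` with an
  algebra map `ε : 𝒜 → F` such that `r·r = ε(r)²` (section `Elim`; `𝒜 = R(0̄)`, `ε = |·|`):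
  Lemma 4.4 (projection keeps a linear diagonal: `mk_mem_linElems_of_totalDegree_le_one`);
  Lemma 4.5 (off-diagonal entries may be replaced by their absolute values without changing the
  determinant — by Prop. 2.1, each term of the involution expansion only sees squares of
  off-diagonal entries: `det_eq_det_nf`, `prod_eq_prod_of_invol`); Lemmas 4.6–4.7 (the algorithm
  `iso_i`: when `|A_{ii}| ≠ 0`, simultaneous row-and-column operations with `α_j = A_{ij}|A_{ii}|⁻¹`
  isolate row/column `i`, keep the matrix symmetric and the diagonal linear, `A_{jj} ↦ A_{jj} +
  α_j² A_{ii}` — done in ONE congruence by `E = 1 + Σ_{j≠i} α_j E_{ji}`, `det E = 1`, then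
  Lemma 4.5: `det_nf_iso` with data `isoVec`/`isoD`/`isoC`); Lemma 4.8 (no diagonal entry
  invertible but `A_{11} ≠ 0 ≠ A_{1j}`: border by a first row/column `(1, 1, 0, …)` —
  `det B = det A`, `det_nf_border` — whose entry `A_{11} + 1` IS invertible, so that
  `det A = (A_{11}+1)·det Ã` with `Ã` having an invertible diagonal entry
  `A_{jj} + A_{1j}²(A_{11}+1)`);
  and the printed induction on the dimension (`elim`, by `Fintype.card`; the isolated entry is
  peeled off by `det_nf_peel`; a zero diagonal gives a constant determinant). The passage from the
  tuple `0̄` to an arbitrary tuple of squares `ℓ²` (`det_isLinFactorizableMod_zero` →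
  `det_isLinFactorizableMod_sq`) is the involutive `F`-automorphism `x_v ↦ x_v + ℓ_v` (`shift`),
  which in characteristic `2` maps `x_v² + ℓ_v²` to `x_v²` and affine polynomials to affine
  polynomials (§5.1, p0011: "the possibility to factorize a polynomial modulo `𝓘(ℓ²)` does not
  depend on `ℓ²`"). The strengthening printed after Thm. 4.10 (p0009: factors with
  quadratic-residue coefficients over infinite fields) is not typed.
* **§4.2 "An example" (p0009; the first filing p484365 said p0010 — locator erratum of record,
  ref-2 g8 row 388).** "The ring `R(1,1,1)` [over `𝔽₂`] has 256 elements, 136 of which can be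
  written as the product of linear polynomials, 120 of which can not. The element `π(xy+z)`
  is one of those. Therefore, Theorem 4.2 tells us that the polynomial `xy + z` can not be
  represented as the determinant of a symmetric matrix with entries in `𝔽₂ ∪ {x,y,z}`." Typed and
  PROVED over EVERY field `F` of characteristic `2` (the form GKKP 2011 §1.1 quotes):
  `not_isLinFactorizableMod_zero_X_mul_X_add_X` (`xy + z` is not factorizable modulo `R(0̄)` — in
  place of the machine count we follow the paper's own Lemmas 5.2–5.3 (§5.1, p0011) at `𝓘_0`:
  constant terms force exactly one factor `L_j` without constant term, the coefficients of `x`,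
  `y`, `z` force `L_j = b·z`, and then every monomial of `L_1⋯L_k` is divisible by `z`,
  contradicting the monomial `xy`; this part holds over every field), hence
  `not_hasSymmDetRepr_X_mul_X_add_X : ∀ N, ¬ HasSymmDetRepr (x₀x₁ + x₂) N`,
  `not_representable_X_mul_X_add_X`, and the junk value `symmDeterminantalComplexity_X_mul_X_add_X
  : sdc(x₀x₁ + x₂) = 0`.
* **GKKP 2011 §1.1 (quoted above; held text `paper:arxiv-1007.3804`).** `PER_2 = x₀₀x₁₁ + x₀₁x₁₀`
  (`perPoly_fin_two`) has no symmetric affine representation of any size in characteristic `2`: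
  `not_hasSymmDetRepr_perPoly_two` (substitute `x₁₀ ↦ 1`, `hasSymmDetRepr_aeval_of_affine`),
  `symmDeterminantalComplexity_perPoly_two : sdc(PER_2) = 0` (the example named in the docstring
  of `symmDeterminantalComplexity`), `not_representable_perPoly_two`. COROLLARY assembled in the
  tree (not printed beyond `n = 2`): `not_hasSymmDetRepr_detPoly` / `not_hasSymmDetRepr_perPoly` —
  for every `n ≥ 2`, `DET_n` and `PER_n` (`= DET_n` in characteristic `2`) have no symmetric affine
  representation of any size (a representation of `DET_n` would pull back along the universality
  substitution `x_{ij} ↦ A_{ij}`, `xy + z = det A`, to one of `xy + z`); so `sdc(DET_n) = sdc(PER_n)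
  = 0` (junk) in characteristic `2` (`symmDeterminantalComplexity_detPoly/_perPoly`).
* **Theorem 6.1 (p0014).** "Let `F` be some field and `P ∈ F[x_1,…,x_m]` be a polynomial. Then,
  `P` can be written as the determinant of an alternating matrix with entries in
  `F ∪ {x_1,…,x_m}` if, and only if, `P` is a square." (⇒): `isSquare_det_of_alternating`, over
  any commutative ring of coefficients and for arbitrary entries, from the tree's Cayley theorem
  `Literature.LinearAlgebra.Matrix.det_eq_pfaffian_sq` (the source cites Lang, *Algebra*, XV §9).
  (⇐): `exists_alternating_affine_det_eq_of_isSquare`, the printed matrix `M = [[0, N], [-Nᵀ, 0]]`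
  with `det M = (det N)²` (`det_fromBlocks_zero_neg_transpose_zero`), where `N` is supplied by
  the tree's affine universality of the determinant `exists_hasDetRepr_holds` (Valiant 1979) —
  hence in the AFFINE-entries reading (entries of degree `≤ 1`, GMT p0003 "essentially
  equivalent"); the printed `N` "with entries in `F ∪ {x_1,…,x_m}`" [Valiant 1979] is not the
  tree's form of universality.

## Deliberately NOT typed

Lemma 3.2 / GKKP Prop. 1 ("`P²` is representable"; the affine form is the tree's
`GKKP2011_prop1`, discharged), Prop. 3.3 and Thm. 3.5 (gSDRs; graph constructions), Lemma 4.9,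
Thm. 4.10 (characterisation for multilinear polynomials over finite fields), Lemma 4.11 and
Thm. 4.12 (§4.4), §5 (Lemmas 5.2–5.5, Cor. 5.6, the algorithms of Thms. 5.8, 5.10 — Lemmas 5.2/5.3
are used only inside the proof for `xy + z`), Thm. 6.1 (⇐) with entries in `F ∪ {x}` proper
(only the affine reading is typed), and the Conjecture of §7 (an open problem — not Literature
material).

## References

* [GrenetMonteilThomasse2013] B. Grenet, T. Monteil, S. Thomassé, *Symmetric determinantal
  representations in characteristic 2*, Linear Algebra Appl. 439 (2013) 1364–1381,
  doi:10.1016/j.laa.2013.04.022, arXiv:1210.5879 — Def. 1.1 and the example (p0003), Prop. 2.1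
  and §2.2 (p0004), Lemma 3.1 (p0005), Def. 4.1 and Thm. 4.2 (p0007), Lemmas 4.4–4.8 and the proof
  (p0007–p0009), §4.2 (p0009), Thm. 4.10 (p0009), Lemmas 5.2–5.3 (p0011), Thm. 6.1 (p0014).
* [ValiantSTOC1979] L. G. Valiant, *Completeness classes in algebra*, STOC 1979, Thm. 1
  (universality of the determinant) — via the tree's `exists_hasDetRepr_holds`.
* [GrenetEtAl2011] B. Grenet, E. L. Kaltofen, P. Koiran, N. Portier, Contemp. Math. 556 (2011) =
  arXiv:1007.3804, §1.1 (the two quoted sentences) and Lemma 6 (via the tree's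
  `Matrix.det_eq_sum_involutive_of_charTwo`).
* S. Lang, *Algebra*, 3rd ed., GTM 211, XV §9 (Pfaffians) — via the tree's
  `Literature.LinearAlgebra.Matrix.det_eq_pfaffian_sq` [cite: Cayley1849].
-/

noncomputable section

open Matrix MvPolynomial Finset

namespace Literature.Barriers.ValiantsHypothesis

namespace GMT2013

universe u

/-! ## The elimination of GMT13 §4.1 (Lemmas 4.5–4.8 and the proof of Theorem 4.2), abstractly

We run the printed algorithm over a commutative `F`-algebra `𝒜` of characteristic `2` together
with an `F`-algebra map `ε : 𝒜 → F` such that `r · r = ε(r)²` for all `r` (in the application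
`𝒜 = R(0̄) = F[x]/⟨x_v²⟩` and `ε = |·|` is the evaluation at `0`, GMT §2.2). A gSDR with constant
off-diagonal part (GMT Lemma 4.5, Def. 4.3) is encoded by its diagonal `d : ι → 𝒜` and its
constant part `c : Matrix ι ι F` as `nf d c`. -/

section Elim

variable {F : Type*} [Field F] {𝒜 : Type*} [CommRing 𝒜] [Algebra F 𝒜]

/-- `r` is a product of finitely many elements of the submodule `Lin` ("linear elements").
[cite: GrenetMonteilThomasse2013, Def. 4.1 ("`π_ℓ(P) = t_1 × ⋯ × t_k`", linear `t_i`)] -/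
def IsLinProduct (Lin : Submodule F 𝒜) (r : 𝒜) : Prop :=
  ∃ (n : ℕ) (t : Fin n → 𝒜), (∀ j, t j ∈ Lin) ∧ ∏ j, t j = r

/-- An element of `Lin` is a (one-factor) product of elements of `Lin`. [folklore] -/
private theorem IsLinProduct.of_mem {Lin : Submodule F 𝒜} {t : 𝒜} (ht : t ∈ Lin) :
    IsLinProduct Lin t :=
  ⟨1, fun _ => t, fun _ => ht, by simp⟩

/-- Products of elements of `Lin` are closed under multiplication by an element of `Lin`.
[folklore] -/
private theorem IsLinProduct.mul_left {Lin : Submodule F 𝒜} {r t : 𝒜} (ht : t ∈ Lin)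
    (hr : IsLinProduct Lin r) : IsLinProduct Lin (t * r) := by
  obtain ⟨n, u, hu, rfl⟩ := hr
  refine ⟨n + 1, Fin.cons t u, fun j => ?_, ?_⟩
  · refine Fin.cases ?_ (fun j => ?_) j
    · simpa using ht
    · simpa using hu j
  · rw [Fin.prod_univ_succ]
    simp

variable {ι : Type*} [DecidableEq ι]

/-- The normal form `N(d, c)`: diagonal `d` (elements of `𝒜`), off-diagonal CONSTANTS `c`.
[cite: GrenetMonteilThomasse2013, Lemma 4.5 (gSDR "whose non-diagonal entries are constants")] -/
def nf (d : ι → 𝒜) (c : Matrix ι ι F) : Matrix ι ι 𝒜 :=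
  Matrix.of fun i j => if i = j then d i else algebraMap F 𝒜 (c i j)

/-- Diagonal entries of `nf d c`. [folklore] -/
@[simp] private theorem nf_apply_same (d : ι → 𝒜) (c : Matrix ι ι F) (i : ι) :
    nf d c i i = d i := by
  simp [nf]

/-- Off-diagonal entries of `nf d c`. [folklore] -/
private theorem nf_apply_of_ne (d : ι → 𝒜) (c : Matrix ι ι F) {i j : ι} (h : i ≠ j) :
    nf d c i j = algebraMap F 𝒜 (c i j) := by
  simp [nf, h]

/-- `nf d c` is symmetric when `c` is. [folklore] -/
private theorem nf_isSymm (d : ι → 𝒜) {c : Matrix ι ι F} (hc : c.IsSymm) : (nf d c).IsSymm := by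
  refine Matrix.IsSymm.ext fun i j => ?_
  by_cases h : i = j
  · subst h; rfl
  · rw [nf_apply_of_ne d c (Ne.symm h), nf_apply_of_ne d c h, hc.apply i j]

/-- Pairing along a fixed-point-free involution: if `g`, `h` are `σ`-invariant and have the same
squares, their products over a `σ`-stable set agree (the orbits are pairs `{i, σ i}`). [folklore] -/
private theorem prod_eq_prod_of_invol {σ : Equiv.Perm ι} (hσ : ∀ i, σ (σ i) = i)
    (g h : ι → 𝒜) (hg : ∀ i, g (σ i) = g i) (hh : ∀ i, h (σ i) = h i)
    (hgh : ∀ i, σ i ≠ i → g i * g i = h i * h i) :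
    ∀ S : Finset ι, (∀ i ∈ S, σ i ∈ S) → (∀ i ∈ S, σ i ≠ i) →
      ∏ i ∈ S, g i = ∏ i ∈ S, h i := by
  intro S
  induction S using Finset.strongInduction with
  | H S ih =>
    intro hstab hfree
    rcases S.eq_empty_or_nonempty with rfl | ⟨i, hi⟩
    · simp
    have hσi : σ i ∈ S.erase i := Finset.mem_erase.2 ⟨hfree i hi, hstab i hi⟩
    set T := (S.erase i).erase (σ i) with hT
    have hTS : T ⊂ S := lt_of_le_of_lt (Finset.erase_subset _ _) (Finset.erase_ssubset hi)
    have hTstab : ∀ j ∈ T, σ j ∈ T := by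
      intro j hj
      simp only [hT, Finset.mem_erase] at hj ⊢
      obtain ⟨hj1, hj2, hj3⟩ := hj
      refine ⟨fun h => hj2 ?_, fun h => hj1 ?_, hstab j hj3⟩
      · exact σ.injective h
      · rw [← h, hσ]
    have hTfree : ∀ j ∈ T, σ j ≠ j := fun j hj =>
      hfree j ((Finset.erase_subset _ _) ((Finset.erase_subset _ _) hj))
    have key : ∀ f : ι → 𝒜, (f (σ i) = f i) → ∏ j ∈ S, f j = f i * f i * ∏ j ∈ T, f j := by
      intro f hf
      rw [← Finset.mul_prod_erase S f hi, ← Finset.mul_prod_erase (S.erase i) f hσi, hf, mul_assoc]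
    rw [key g (hg i), key h (hh i), hgh i (hfree i hi), ih T hTS hTstab hTfree]

/-- **GMT13 Lemma 4.5 (abstract form).** For a symmetric matrix over `𝒜`, replacing every
off-diagonal entry by the constant with the same square does not change the determinant
(by the involution expansion, GKKP Lemma 6 = GMT Prop. 2.1).
[cite: GrenetMonteilThomasse2013, Lemma 4.5] -/
theorem det_eq_det_nf [Fintype ι] [CharP 𝒜 2] (ε : 𝒜 →ₐ[F] F)
    (hsq : ∀ r : 𝒜, r * r = algebraMap F 𝒜 (ε r * ε r)) {A : Matrix ι ι 𝒜} (hA : A.IsSymm) :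
    A.det = (nf (fun i => A i i) (Matrix.of fun i j => ε (A i j))).det := by
  have hc : (Matrix.of fun i j => ε (A i j) : Matrix ι ι F).IsSymm :=
    Matrix.IsSymm.ext fun i j => by simp [hA.apply i j]
  have hN := nf_isSymm (fun i => A i i) hc
  rw [Matrix.det_eq_sum_involutive_of_charTwo hA, Matrix.det_eq_sum_involutive_of_charTwo hN]
  refine Finset.sum_congr rfl fun σ hσ => ?_
  have hσ2 : ∀ i, σ (σ i) = i := fun i => by
    have := (Finset.mem_filter.1 hσ).2
    simpa using Equiv.Perm.ext_iff.1 this i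
  rw [← Finset.prod_filter_mul_prod_filter_not Finset.univ (fun i => σ i = i),
    ← Finset.prod_filter_mul_prod_filter_not Finset.univ (fun i => σ i = i)
      (fun i => nf _ _ i (σ i))]
  congr 1
  · refine Finset.prod_congr rfl fun i hi => ?_
    have h := (Finset.mem_filter.1 hi).2
    rw [h, nf_apply_same]
  · refine prod_eq_prod_of_invol hσ2 (fun i => A i (σ i)) (fun i => nf _ _ i (σ i)) ?_ ?_ ?_ _ ?_ ?_
    · intro i; rw [hσ2, hA.apply]
    · intro i; rw [hσ2, hN.apply]
    · intro i hi
      rw [nf_apply_of_ne _ _ (Ne.symm hi), Matrix.of_apply, ← map_mul, ← hsq]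
    · intro i hi
      simp only [Finset.mem_filter, Finset.mem_univ, true_and] at hi ⊢
      rw [hσ2]
      exact fun h => hi h.symm
    · intro i hi
      exact (Finset.mem_filter.1 hi).2

/-! ### Lemma 4.7: isolating an invertible diagonal entry (one congruence, then Lemma 4.5) -/

/-- The multipliers `α_j = A_{ij} · |A_{ii}|⁻¹` of GMT's algorithm `iso_i` (and `α_i = 0`).
[cite: GrenetMonteilThomasse2013, Algorithm 2 (`iso_i`)] -/
def isoVec (c : Matrix ι ι F) (i : ι) (a : F) : ι → F :=
  fun j => if j = i then 0 else c i j / a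

/-- Diagonal after `iso_i`: `A_{jj} + α_j² A_{ii}` (GMT Lemma 4.6).
[cite: GrenetMonteilThomasse2013, Lemma 4.6] -/
def isoD (d : ι → 𝒜) (c : Matrix ι ι F) (i : ι) (a : F) : ι → 𝒜 :=
  fun j => d j + (isoVec c i a j * isoVec c i a j) • d i

/-- Off-diagonal constants after `iso_i`: row and column `i` vanish (GMT Lemma 4.7).
[cite: GrenetMonteilThomasse2013, Lemma 4.7] -/
def isoC (c : Matrix ι ι F) (i : ι) (a : F) : Matrix ι ι F :=
  Matrix.of fun j k => if j = i ∨ k = i then 0 else c j k + c i j * c i k / a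

/-- The multiplier at the pivot vanishes. [folklore] -/
@[simp] private theorem isoVec_self (c : Matrix ι ι F) (i : ι) (a : F) : isoVec c i a i = 0 := by
  simp [isoVec]

/-- The multipliers off the pivot. [folklore] -/
private theorem isoVec_of_ne (c : Matrix ι ι F) {i j : ι} (a : F) (h : j ≠ i) :
    isoVec c i a j = c i j / a := by
  simp [isoVec, h]

/-- The pivot entry is unchanged by `iso_i`. [folklore] -/
@[simp] private theorem isoD_self (d : ι → 𝒜) (c : Matrix ι ι F) (i : ι) (a : F) :
    isoD d c i a i = d i := by
  simp [isoD]

/-- The constant part stays symmetric after `iso_i`. [folklore] -/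
private theorem isoC_isSymm {c : Matrix ι ι F} (hc : c.IsSymm) (i : ι) (a : F) :
    (isoC c i a).IsSymm := by
  refine Matrix.IsSymm.ext fun j k => ?_
  by_cases h : j = i ∨ k = i
  · have h' : k = i ∨ j = i := h.symm
    simp only [isoC, Matrix.of_apply, if_pos h, if_pos h']
  · have h' : ¬ (k = i ∨ j = i) := fun h'' => h h''.symm
    simp only [isoC, Matrix.of_apply, if_neg h, if_neg h']
    rw [hc.apply j k, mul_comm (c i k)]

/-- After `iso_i` the pivot row of the constant part vanishes. [folklore] -/
private theorem isoC_row (c : Matrix ι ι F) (i : ι) (a : F) (k : ι) : isoC c i a i k = 0 := by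
  simp [isoC]

/-- After `iso_i` the pivot column of the constant part vanishes. [folklore] -/
private theorem isoC_col (c : Matrix ι ι F) (i : ι) (a : F) (k : ι) : isoC c i a k i = 0 := by
  simp [isoC]

section MulLemmas

variable [Fintype ι]

/-- Left multiplication by the rank-one matrix `v e_iᵀ` picks row `i`. [folklore] -/
private theorem vecMulVec_single_mul (V : ι → 𝒜) (i : ι) (A : Matrix ι ι 𝒜) :
    vecMulVec V (Pi.single i 1) * A = vecMulVec V (fun k => A i k) := by
  ext j k
  simp [Matrix.mul_apply, vecMulVec_apply, Pi.single_apply, Finset.sum_ite_eq']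

/-- Right multiplication by `e_i vᵀ` picks column `i`. [folklore] -/
private theorem mul_vecMulVec_single (V : ι → 𝒜) (i : ι) (A : Matrix ι ι 𝒜) :
    A * vecMulVec (Pi.single i 1) V = vecMulVec (fun j => A j i) V := by
  ext j k
  simp [Matrix.mul_apply, vecMulVec_apply, Pi.single_apply, Finset.sum_ite_eq']

/-- The congruence matrix `1 + v e_iᵀ` (`v_i = 0`) is unimodular. [folklore] -/
private theorem det_one_add_vecMulVec_single (V : ι → 𝒜) (i : ι) (hV : V i = 0) :
    (1 + vecMulVec V (Pi.single i (1 : 𝒜))).det = 1 := by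
  rw [Matrix.vecMulVec_eq (ι := Unit), Matrix.det_one_add_replicateCol_mul_replicateRow,
    single_dotProduct, one_mul, hV, add_zero]

end MulLemmas

/-- **GMT13 Lemmas 4.6–4.7 (abstract form).** If `|A_{ii}| ≠ 0`, the congruence by
`E = 1 + Σ_{j ≠ i} α_j E_{ji}` followed by Lemma 4.5 isolates the `i`-th row and column without
changing the determinant, `A_{ii}`, or the linearity of the diagonal.
[cite: GrenetMonteilThomasse2013, Lemmas 4.6–4.7] -/
theorem det_nf_iso [Fintype ι] [CharP F 2] [CharP 𝒜 2] (ε : 𝒜 →ₐ[F] F)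
    (hsq : ∀ r : 𝒜, r * r = algebraMap F 𝒜 (ε r * ε r)) (d : ι → 𝒜) {c : Matrix ι ι F}
    (hc : c.IsSymm) (i : ι) (ha : ε (d i) ≠ 0) :
    (nf d c).det = (nf (isoD d c i (ε (d i))) (isoC c i (ε (d i)))).det := by
  set a := ε (d i) with ha_def
  set A := nf d c with hA_def
  have hAs : A.IsSymm := nf_isSymm d hc
  let V : ι → 𝒜 := fun j => algebraMap F 𝒜 (isoVec c i a j)
  have hVj : ∀ j, V j = algebraMap F 𝒜 (isoVec c i a j) := fun j => rfl
  have hVi : V i = 0 := by simp [hVj]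
  have hdetE : (1 + vecMulVec V (Pi.single i (1 : 𝒜))).det = 1 :=
    det_one_add_vecMulVec_single V i hVi
  set Y := (1 + vecMulVec V (Pi.single i (1 : 𝒜))) * A * (1 + vecMulVec V (Pi.single i (1 : 𝒜)))ᵀ
    with hY_def
  -- entries of the congruent matrix
  have hY : ∀ j k, Y j k = A j k + V j * A i k + A j i * V k + A i i * V j * V k := by
    intro j k
    rw [hY_def, transpose_add, transpose_one, transpose_vecMulVec, Matrix.add_mul, Matrix.one_mul,
      vecMulVec_single_mul, Matrix.mul_add, Matrix.mul_one, mul_vecMulVec_single]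
    simp only [Matrix.add_apply, vecMulVec_apply]
    ring
  have hYs : Y.IsSymm := by
    rw [Matrix.IsSymm, hY_def, transpose_mul, transpose_mul, transpose_transpose, hAs.eq,
      Matrix.mul_assoc]
  have hdetY : Y.det = A.det := by
    rw [hY_def, det_mul, det_mul, det_transpose, hdetE, one_mul, mul_one]
  rw [← hdetY, det_eq_det_nf ε hsq hYs]
  -- identify the normal form of `Y` with `N(isoD, isoC)`
  have hAjj : ∀ j, A j j = d j := fun j => nf_apply_same d c j
  have hAjk : ∀ {j k}, j ≠ k → A j k = algebraMap F 𝒜 (c j k) := fun h => nf_apply_of_ne d c h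
  congr 1
  ext j k
  by_cases hjk : j = k
  · subst hjk
    rw [nf_apply_same, nf_apply_same, hY j j]
    by_cases hji : j = i
    · subst hji
      rw [hVi, isoD_self, hAjj]
      ring
    · rw [hAjj j, hAjj i, hAs.apply i j, hAjk (Ne.symm hji), isoD, hVj j, Algebra.smul_def, map_mul]
      have h2 : algebraMap F 𝒜 (isoVec c i a j) * algebraMap F 𝒜 (c i j) +
          algebraMap F 𝒜 (c i j) * algebraMap F 𝒜 (isoVec c i a j) = 0 := by
        rw [mul_comm, CharTwo.add_self_eq_zero]
      linear_combination h2
  · rw [nf_apply_of_ne _ _ hjk, nf_apply_of_ne _ _ hjk, Matrix.of_apply, hY j k]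
    congr 1
    by_cases hji : j = i
    · subst hji
      have hkj : k ≠ j := Ne.symm hjk
      rw [isoC_row, hVi, hAjj, hAjk hjk, hVj k, isoVec_of_ne c a hkj]
      simp only [zero_mul, mul_zero, add_zero, map_add, map_mul, AlgHom.commutes,
        Algebra.algebraMap_self_apply]
      rw [← ha_def, mul_div_assoc', mul_div_cancel_left₀ _ ha, CharTwo.add_self_eq_zero]
    · by_cases hki : k = i
      · subst hki
        rw [isoC_col, hVi, hAjj, hAjk hji, hVj j, isoVec_of_ne c a hji, hc.apply k j]
        simp only [mul_zero, add_zero, map_add, map_mul, AlgHom.commutes,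
          Algebra.algebraMap_self_apply]
        rw [← ha_def, div_mul_cancel₀ _ ha, CharTwo.add_self_eq_zero]
      · have hik : i ≠ k := Ne.symm hki
        rw [hAjk hjk, hAjk hik, hAjk hji, hAjj, hVj j, hVj k, isoVec_of_ne c a hji,
          isoVec_of_ne c a hki, hc.apply i j]
        simp only [map_add, map_mul, AlgHom.commutes, Algebra.algebraMap_self_apply, isoC,
          Matrix.of_apply, hji, hki, or_self, if_false]
        rw [← ha_def]
        have h3 : a * (c i j / a) * (c i k / a) = c i j * c i k / a := by
          field_simp
        rw [h3, div_mul_eq_mul_div, ← mul_div_assoc]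
        set z := c i j * c i k / a
        calc c j k + z + z + z = c j k + (z + z) + z := by ring
          _ = c j k + z := by rw [CharTwo.add_self_eq_zero, add_zero]

/-! ### Peeling an isolated diagonal entry -/

/-- If the `i`-th column of the constant part vanishes, `det N(d, c) = d_i · det N(d, c)|_{≠ i}`.
[cite: GrenetMonteilThomasse2013, proof of Thm. 4.2 (p0009: "removing the `i`th row and column")] -/
theorem det_nf_peel [Fintype ι] (d : ι → 𝒜) (c : Matrix ι ι F) (i : ι)
    (hcol : ∀ k, k ≠ i → c k i = 0) :
    (nf d c).det = d i * (nf (fun j : {a // ¬ a = i} => d j)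
      (c.submatrix Subtype.val Subtype.val)).det := by
  rw [Matrix.twoBlockTriangular_det (nf d c) (fun a => a = i)]
  · congr 1
    · haveI : Subsingleton {a // a = i} := ⟨fun x y => Subtype.ext (x.2.trans y.2.symm)⟩
      have h := Matrix.det_eq_elem_of_subsingleton
        ((nf d c).toSquareBlockProp (fun a => a = i)) ⟨i, rfl⟩
      convert h using 1
      all_goals simp [Matrix.toSquareBlockProp, Matrix.toBlock_apply]
    · congr 1
      ext x y
      simp only [Matrix.toSquareBlockProp, Matrix.toBlock_apply, nf, Matrix.of_apply,
        Matrix.submatrix_apply, Subtype.val_inj]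
  · intro k hk j hj
    subst hj
    rw [nf_apply_of_ne d c hk, hcol k hk, map_zero]

/-- Removing one point lowers the cardinality by one. [folklore] -/
private theorem card_subtype_ne [Fintype ι] (i : ι) {n : ℕ} (h : Fintype.card ι = n + 1) :
    Fintype.card {a // ¬ a = i} = n := by
  have h1 : Fintype.card {a // a = i} = 1 := by convert Fintype.card_subtype_eq i
  rw [Fintype.card_subtype_compl, h1, h, Nat.add_sub_cancel]

/-! ### Lemma 4.8: bordering -/

/-- Diagonal of the bordered matrix `B` of GMT Lemma 4.8: a new corner `1`, and `A_{ii} + 1`.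
[cite: GrenetMonteilThomasse2013, Lemma 4.8 (the matrix `B`)] -/
def borderD (d : ι → 𝒜) (i : ι) : Unit ⊕ ι → 𝒜 :=
  Sum.elim (fun _ => 1) (fun j => if j = i then d i + 1 else d j)

/-- Constant part of the bordered matrix: the corner is joined to `i` by an edge of weight `1`.
[cite: GrenetMonteilThomasse2013, Lemma 4.8 (the matrix `B`)] -/
def borderC (c : Matrix ι ι F) (i : ι) : Matrix (Unit ⊕ ι) (Unit ⊕ ι) F :=
  Matrix.fromBlocks 0 (Matrix.of fun _ j => if j = i then 1 else 0)
    (Matrix.of fun j _ => if j = i then 1 else 0) c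

/-- The corner entry of the bordered diagonal. [folklore] -/
@[simp] private theorem borderD_inl (d : ι → 𝒜) (i : ι) (u : Unit) : borderD d i (Sum.inl u)
    = 1 := rfl

/-- The bordered diagonal at the pivot. [folklore] -/
@[simp] private theorem borderD_inr_self (d : ι → 𝒜) (i : ι) : borderD d i (Sum.inr i)
    = d i + 1 := by
  simp [borderD]

/-- The bordered diagonal off the pivot. [folklore] -/
private theorem borderD_inr_of_ne (d : ι → 𝒜) {i k : ι} (h : k ≠ i) : borderD d i (Sum.inr k)
    = d k := by
  simp [borderD, h]

/-- The old block of the bordered constant part. [folklore] -/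
@[simp] private theorem borderC_inr_inr (c : Matrix ι ι F) (i j k : ι) :
    borderC c i (Sum.inr j) (Sum.inr k) = c j k := rfl

/-- The border edge of weight `1`. [folklore] -/
@[simp] private theorem borderC_inr_inl (c : Matrix ι ι F) (i : ι) (u : Unit) :
    borderC c i (Sum.inr i) (Sum.inl u) = 1 := by
  simp [borderC]

/-- The bordered constant part is symmetric. [folklore] -/
private theorem borderC_isSymm {c : Matrix ι ι F} (hc : c.IsSymm) (i : ι) :
    (borderC c i).IsSymm := by
  refine Matrix.IsSymm.fromBlocks (by simp [Matrix.IsSymm]) ?_ hc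
  ext j u
  simp

/-- **GMT13 Lemma 4.8, first half.** Bordering does not change the determinant:
`det B = det A` (subtract the new first row and column from the `i`-th ones).
[cite: GrenetMonteilThomasse2013, Lemma 4.8] -/
theorem det_nf_border [Fintype ι] (d : ι → 𝒜) (c : Matrix ι ι F) (i : ι) :
    (nf (borderD d i) (borderC c i)).det = (nf d c).det := by
  set Brow : Matrix Unit ι 𝒜 := Matrix.of fun _ j => if j = i then 1 else 0 with hBrow
  set Bcol : Matrix ι Unit 𝒜 := Matrix.of fun j _ => if j = i then 1 else 0 with hBcol
  have hB : nf (borderD d i) (borderC c i) =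
      Matrix.fromBlocks 1 Brow Bcol (nf (fun j => if j = i then d i + 1 else d j) c) := by
    ext (u | j) (u' | k)
    · simp [nf]
    · simp [nf, borderC, hBrow, apply_ite (algebraMap F 𝒜)]
    · simp [nf, borderC, hBcol, apply_ite (algebraMap F 𝒜)]
    · by_cases h : j = k
      · subst h; simp [nf, borderD]
      · simp [nf, h, borderD]
  rw [hB, Matrix.det_fromBlocks_one₁₁]
  congr 1
  ext j k
  have hmul : (Bcol * Brow) j k = (if j = i then 1 else 0) * (if k = i then 1 else 0) := by
    simp [Matrix.mul_apply, hBrow, hBcol]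
  rw [Matrix.sub_apply, hmul]
  by_cases h : j = k
  · subst h
    by_cases hji : j = i <;> simp [nf, hji]
  · by_cases hji : j = i
    · subst hji
      have hki : ¬ k = j := fun e => h e.symm
      simp [nf, h, hki]
    · simp [nf, h, hji]

/-! ### The elimination (proof of GMT13 Theorem 4.2, p0009) -/

/-- **Abstract GMT13 Theorem 4.2.** Over an `F`-algebra `𝒜` of characteristic `2` in which every
square is the square of a constant (`r² = |r|²`, `|·| = ε`), the determinant of a symmetric matrix
with diagonal entries in a submodule `Lin ∋ 1` ("linear elements") and constant off-diagonal entries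
is a product of elements of `Lin`.  Proof = GMT's algorithm: isolate an invertible diagonal entry
(Lemma 4.7) and recurse; if none is invertible but some nonzero diagonal entry has a nonzero
off-diagonal neighbour, border first (Lemma 4.8); otherwise peel an isolated diagonal entry or,
when the diagonal vanishes, the determinant is a constant. Induction on the dimension.
[cite: GrenetMonteilThomasse2013, Thm. 4.2 (proof, §4.1 p0009)] -/
theorem elim [CharP F 2] [CharP 𝒜 2] (ε : 𝒜 →ₐ[F] F)
    (hsq : ∀ r : 𝒜, r * r = algebraMap F 𝒜 (ε r * ε r)) (Lin : Submodule F 𝒜)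
    (h1 : (1 : 𝒜) ∈ Lin) :
    ∀ (n : ℕ) (κ : Type u) [Fintype κ] [DecidableEq κ], Fintype.card κ = n →
      ∀ (d : κ → 𝒜) (c : Matrix κ κ F), (∀ i, d i ∈ Lin) → c.IsSymm →
        IsLinProduct Lin (nf d c).det := by
  intro n
  induction n with
  | zero =>
    intro κ _ _ hcard d c _ _
    haveI : IsEmpty κ := Fintype.card_eq_zero_iff.mp hcard
    exact ⟨0, Fin.elim0, fun j => j.elim0, by simp [Matrix.det_isEmpty]⟩
  | succ n ih =>
    -- Case A: some diagonal entry is invertible (Lemma 4.7, then recurse)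
    have caseA : ∀ (κ : Type u) [Fintype κ] [DecidableEq κ], Fintype.card κ = n + 1 →
        ∀ (d : κ → 𝒜) (c : Matrix κ κ F), (∀ i, d i ∈ Lin) → c.IsSymm →
          ∀ i, ε (d i) ≠ 0 → IsLinProduct Lin (nf d c).det := by
      intro κ _ _ hcard d c hd hc i hi
      rw [det_nf_iso ε hsq d hc i hi, det_nf_peel _ _ i (fun k _ => isoC_col c i _ k), isoD_self]
      refine IsLinProduct.mul_left (hd i) (ih _ (card_subtype_ne i hcard) _ _ (fun j => ?_) ?_)
      · dsimp only [isoD]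
        exact Lin.add_mem (hd _) (Lin.smul_mem _ (hd i))
      · exact (isoC_isSymm hc i _).submatrix _
    intro κ _ _ hcard d c hd hc
    by_cases hA : ∃ i, ε (d i) ≠ 0
    · obtain ⟨i, hi⟩ := hA
      exact caseA κ hcard d c hd hc i hi
    push Not at hA
    by_cases h0 : ∀ i, d i = 0
    · -- the diagonal vanishes: the determinant is a constant
      have hN : nf d c = (algebraMap F 𝒜).mapMatrix
          (Matrix.of fun i j => if i = j then 0 else c i j) := by
        ext i j
        by_cases h : i = j
        · subst h; simp [nf, h0]
        · simp [nf, h]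
      refine IsLinProduct.of_mem ?_
      rw [hN, ← RingHom.map_det, Algebra.algebraMap_eq_smul_one]
      exact Lin.smul_mem _ h1
    push Not at h0
    obtain ⟨i, hi⟩ := h0
    by_cases hrow : ∀ k, k ≠ i → c i k = 0
    · -- `A_{ii}` is isolated: peel it
      rw [det_nf_peel d c i (fun k hk => by rw [hc.apply i k]; exact hrow k hk)]
      exact IsLinProduct.mul_left (hd i)
        (ih _ (card_subtype_ne i hcard) _ _ (fun j => hd _) (hc.submatrix _))
    push Not at hrow
    obtain ⟨k, hki, hcik⟩ := hrow
    -- Lemma 4.8: border, isolate the new invertible entry `A_{ii} + 1`, and land in Case A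
    rw [← det_nf_border d c i]
    have hb : ε (borderD d i (Sum.inr i)) ≠ 0 := by
      rw [borderD_inr_self, map_add, map_one, hA i, zero_add]
      exact one_ne_zero
    have hbs := borderC_isSymm hc i
    rw [det_nf_iso ε hsq (borderD d i) hbs (Sum.inr i) hb,
      det_nf_peel _ _ (Sum.inr i) (fun x _ => isoC_col _ _ _ x), isoD_self, borderD_inr_self]
    refine IsLinProduct.mul_left (Lin.add_mem (hd i) h1) (caseA _ ?_ _ _ (fun j => ?_) ?_
      ⟨Sum.inr k, by simpa using hki⟩ ?_)
    · rw [card_subtype_ne (Sum.inr i)]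
      rw [Fintype.card_sum, Fintype.card_unit, hcard, add_comm]
    · dsimp only [isoD]
      refine Lin.add_mem ?_ (Lin.smul_mem _ ?_)
      · obtain ⟨x, hx⟩ := j
        rcases x with u | k'
        · exact h1
        · by_cases hk' : k' = i
          · subst hk'
            rw [borderD_inr_self]
            exact Lin.add_mem (hd _) h1
          · rw [borderD_inr_of_ne d hk']
            exact hd k'
      · rw [borderD_inr_self]
        exact Lin.add_mem (hd i) h1
    · exact (isoC_isSymm hbs _ _).submatrix _
    · have ha1 : ε (d i + 1) = 1 := by
        rw [map_add, map_one, hA i, zero_add]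
      have hne : (Sum.inr k : Unit ⊕ κ) ≠ Sum.inr i := by simpa using hki
      show ε (isoD (borderD d i) (borderC c i) (Sum.inr i) (ε (d i + 1)) (Sum.inr k)) ≠ 0
      rw [ha1, isoD, isoVec_of_ne _ _ hne, borderC_inr_inr, borderD_inr_of_ne d hki,
        borderD_inr_self, map_add, map_smul, map_add, map_one, hA k, hA i, zero_add, zero_add,
        div_one, smul_eq_mul, mul_one]
      exact mul_ne_zero hcik hcik

end Elim

/-! ## The quotient ring `R(0) = F[x]/⟨x_v²⟩` (GMT §2.2 at the tuple `ℓ = 0`) -/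

section SqZero

variable (F : Type*) [Field F] (σ : Type*)

/-- GMT §2.2: the ideal `𝓘(ℓ) = ⟨x_1² + ℓ_1, …, x_m² + ℓ_m⟩` of `F[x_1, …, x_m]`
("`R(ℓ) = F[x]/𝓘(ℓ)`"; in characteristic `2`, `x² + ℓ = x² - ℓ`).
[cite: GrenetMonteilThomasse2013, §2.2] -/
def sqIdeal (ℓ : σ → F) : Ideal (MvPolynomial σ F) :=
  Ideal.span (Set.range fun v : σ => (X v : MvPolynomial σ F) ^ 2 + C (ℓ v))

/-- The quotient ring `R(0) = F[x]/⟨x_v² : v⟩` of GMT §2.2 (tuple `ℓ = 0̄`, §5.1 "`𝓘_0`").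
[cite: GrenetMonteilThomasse2013, §2.2] -/
abbrev SqZero : Type _ := MvPolynomial σ F ⧸ sqIdeal F σ 0

variable {F σ}

/-- The generators of `𝓘(ℓ)`. [folklore] -/
private theorem X_sq_add_C_mem_sqIdeal (ℓ : σ → F) (v : σ) :
    (X v : MvPolynomial σ F) ^ 2 + C (ℓ v) ∈ sqIdeal F σ ℓ :=
  Ideal.subset_span ⟨v, rfl⟩

/-- The generators of `𝓘(0̄)`. [folklore] -/
private theorem X_sq_mem_sqIdeal_zero (v : σ) : (X v : MvPolynomial σ F) ^ 2 ∈ sqIdeal F σ 0 := by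
  simpa using X_sq_add_C_mem_sqIdeal (0 : σ → F) v

/-- `x̄_v² = 0` in `R(0̄)`. [folklore] -/
private theorem mk_X_mul_mk_X (v : σ) :
    (Ideal.Quotient.mk (sqIdeal F σ 0) (X v)) * (Ideal.Quotient.mk (sqIdeal F σ 0) (X v)) = 0 := by
  rw [← map_mul, ← pow_two, Ideal.Quotient.eq_zero_iff_mem]
  exact X_sq_mem_sqIdeal_zero v

/-- Constants of `R(0̄)`. [folklore] -/
private theorem mk_C (a : F) :
    Ideal.Quotient.mk (sqIdeal F σ 0) (C a) = algebraMap F (SqZero F σ) a := rfl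

/-- GMT §2.2: the absolute value `|·|` on `R(0)` is the evaluation `x_v ↦ 0` (for the tuple of
squares `ℓ² = 0̄`, `|r|` is the constant with `r² = |r|²`).
[cite: GrenetMonteilThomasse2013, §2.2] -/
def absZero : SqZero F σ →ₐ[F] F :=
  Ideal.Quotient.liftₐ (sqIdeal F σ 0) (MvPolynomial.aeval fun _ : σ => (0 : F)) (by
    intro a ha
    have h : sqIdeal F σ 0 ≤ RingHom.ker (MvPolynomial.aeval fun _ : σ => (0 : F)) := by
      refine Ideal.span_le.2 ?_
      rintro _ ⟨v, rfl⟩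
      simp [RingHom.mem_ker]
    exact h ha)

/-- `|·|` on representatives is the evaluation at `0`. [folklore] -/
@[simp] private theorem absZero_mk (p : MvPolynomial σ F) :
    absZero (Ideal.Quotient.mk (sqIdeal F σ 0) p) = MvPolynomial.aeval (fun _ : σ => (0 : F)) p :=
  rfl

/-- `R(0)` has characteristic `2` when `F` has. [folklore] -/
private theorem charP_sqZero [CharP F 2] : CharP (SqZero F σ) 2 := by
  refine CharTwo.of_one_ne_zero_of_two_eq_zero ?_ ?_
  · intro h
    have := congrArg (absZero (F := F) (σ := σ)) h
    rw [map_one, map_zero] at this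
    exact one_ne_zero this
  · have h := map_ofNat (algebraMap F (SqZero F σ)) 2
    rw [CharTwo.two_eq_zero, map_zero] at h
    exact h.symm

/-- GMT §2.2: "The square of any element of `R(ℓ)` belongs to `F`": in `R(0)`, `r² = |r|²`
(Frobenius is additive in characteristic `2`, and `x_v² = 0 = |x_v|²`).
[cite: GrenetMonteilThomasse2013, §2.2] -/
theorem mul_self_eq_absZero [CharP F 2] (r : SqZero F σ) :
    r * r = algebraMap F (SqZero F σ) (absZero r * absZero r) := by
  haveI := charP_sqZero (F := F) (σ := σ)
  obtain ⟨p, rfl⟩ := Ideal.Quotient.mk_surjective r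
  rw [absZero_mk]
  induction p using MvPolynomial.induction_on with
  | C a => rw [mk_C, aeval_C, ← map_mul, Algebra.algebraMap_self_apply]
  | add p q hp hq =>
    rw [map_add, map_add, add_mul_self_eq, add_mul_self_eq, CharTwo.two_eq_zero,
      CharTwo.two_eq_zero]
    simp only [zero_mul, add_zero]
    rw [hp, hq, ← map_add]
  | mul_X p v _ =>
    simp only [map_mul, aeval_X, mul_zero, map_zero]
    rw [mul_mul_mul_comm, mk_X_mul_mk_X, mul_zero]

/-- The generators `1, x̄_v` of the linear elements of `R(0)`.
[cite: GrenetMonteilThomasse2013, §2.2 (linear elements)] -/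
def linGen : Option σ → SqZero F σ :=
  fun o => o.elim 1 fun v => Ideal.Quotient.mk (sqIdeal F σ 0) (X v)

/-- GMT §2.2: the linear elements of `R(0)` (projections of polynomials of degree `≤ 1`).
[cite: GrenetMonteilThomasse2013, §2.2] -/
def linElems : Submodule F (SqZero F σ) :=
  Submodule.span F (Set.range (linGen (F := F) (σ := σ)))

/-- `1` is a linear element. [folklore] -/
private theorem one_mem_linElems : (1 : SqZero F σ) ∈ linElems (F := F) (σ := σ) :=
  Submodule.subset_span ⟨none, rfl⟩

/-- The `x̄_v` are linear elements. [folklore] -/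
private theorem mk_X_mem_linElems (v : σ) :
    Ideal.Quotient.mk (sqIdeal F σ 0) (X v) ∈ linElems (F := F) (σ := σ) :=
  Submodule.subset_span ⟨some v, rfl⟩

variable [Fintype σ]

/-- A linear element lifts to an affine polynomial `a + Σ_v b_v x_v`.
[cite: GrenetMonteilThomasse2013, §2.2 ("linear if it is the projection of a linear polynomial")] -/
theorem exists_affine_of_mem_linElems {t : SqZero F σ} (ht : t ∈ linElems (F := F) (σ := σ)) :
    ∃ (a : F) (b : σ → F), Ideal.Quotient.mk (sqIdeal F σ 0) (C a + ∑ v, C (b v) * X v) = t := by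
  obtain ⟨w, rfl⟩ := (Submodule.mem_span_range_iff_exists_fun F).1 ht
  refine ⟨w none, fun v => w (some v), ?_⟩
  rw [Fintype.sum_option, map_add, map_sum]
  simp only [linGen, Option.elim, map_mul, mk_C]
  congr 1
  · exact Algebra.algebraMap_eq_smul_one _
  · exact Finset.sum_congr rfl fun x _ => (Algebra.smul_def _ _).symm

/-- Folklore affine expansion: a polynomial of total degree `≤ 1` is `C a₀ + Σ_v C a_v · x_v`.
[folklore] -/
private theorem eq_C_add_sum_of_totalDegree_le_one [DecidableEq σ] {R : Type*} [CommSemiring R]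
    {p : MvPolynomial σ R} (hp : p.totalDegree ≤ 1) :
    p = C (coeff 0 p) + ∑ v, C (coeff (Finsupp.single v 1) p) * X v := by
  classical
  ext s
  simp only [coeff_add, coeff_C, coeff_sum, coeff_C_mul, coeff_X]
  by_cases hs0 : s = 0
  · subst hs0
    rw [if_pos rfl, Finset.sum_eq_zero (fun v _ => ?_), add_zero]
    rw [if_neg (Finsupp.single_ne_zero.mpr one_ne_zero), mul_zero]
  rw [if_neg (Ne.symm hs0), zero_add]
  by_cases hs1 : ∃ v, s = Finsupp.single v 1
  · obtain ⟨v, rfl⟩ := hs1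
    rw [Finset.sum_eq_single v]
    · rw [if_pos rfl, mul_one]
    · intro w _ hwv
      rw [if_neg (fun h => hwv (Finsupp.single_left_injective one_ne_zero h)), mul_zero]
    · intro h; exact absurd (Finset.mem_univ v) h
  · have hl : coeff s p = 0 := by
      by_contra h
      have hdeg : s.degree ≤ 1 := (le_totalDegree (mem_support_iff.mpr h)).trans hp
      obtain ⟨v, hv⟩ := DFunLike.ne_iff.mp hs0
      simp only [Finsupp.coe_zero, Pi.zero_apply] at hv
      apply hs1 ⟨v, ?_⟩
      ext w
      by_cases hw : w = v
      · subst hw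
        have := Finsupp.le_degree w s
        rw [Finsupp.single_eq_same]
        omega
      · rw [Finsupp.single_eq_of_ne hw]
        by_contra hsw
        have h2 : s v + s w ≤ s.degree := by
          rw [Finsupp.degree_apply]
          calc s v + s w = ∑ i ∈ {v, w}, s i := by rw [Finset.sum_pair (Ne.symm hw)]
            _ ≤ ∑ i ∈ s.support, s i := by
              refine Finset.sum_le_sum_of_subset fun i hi => ?_
              simp only [Finset.mem_insert, Finset.mem_singleton] at hi
              rcases hi with rfl | rfl
              · simpa using hv
              · simpa using hsw
        omega
    rw [hl, eq_comm]
    refine Finset.sum_eq_zero fun v _ => ?_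
    rw [if_neg (fun h => hs1 ⟨v, h.symm⟩), mul_zero]

/-- Lemma 4.4 for the diagonal: the projection of an affine polynomial is a linear element.
[cite: GrenetMonteilThomasse2013, Lemma 4.4] -/
theorem mk_mem_linElems_of_totalDegree_le_one [DecidableEq σ] {p : MvPolynomial σ F}
    (hp : p.totalDegree ≤ 1) :
    Ideal.Quotient.mk (sqIdeal F σ 0) p ∈ linElems (F := F) (σ := σ) := by
  rw [eq_C_add_sum_of_totalDegree_le_one hp, map_add, map_sum]
  refine Submodule.add_mem _ ?_ (Submodule.sum_mem _ fun v _ => ?_)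
  · rw [mk_C, Algebra.algebraMap_eq_smul_one]
    exact Submodule.smul_mem _ _ one_mem_linElems
  · rw [map_mul, mk_C, ← Algebra.smul_def]
    exact Submodule.smul_mem _ _ (mk_X_mem_linElems v)

end SqZero

/-! ## GMT13 Definitions 1.1 and 4.1, and Theorem 4.2 -/

section Statements

variable {F : Type*} [Field F] {σ : Type*}

/-- **GMT13 Definition 1.1 (p0003), the entry condition.** "a symmetric matrix `M` with entries
in `F ∪ {x_1, …, x_m}`": every entry is a constant or a variable.
[cite: GrenetMonteilThomasse2013, Def. 1.1] -/
def HasScalarOrVarEntries {ι : Type*} (M : Matrix ι ι (MvPolynomial σ F)) : Prop :=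
  ∀ i j, (∃ c : F, M i j = C c) ∨ (∃ v : σ, M i j = X v)

/-- **GMT13 Definition 1.1 (p0003).** "A polynomial `P ∈ F[x_1, …, x_m]` is said *representable*
if it has an SDR, that is if there exists a symmetric matrix `M` with entries in
`F ∪ {x_1, …, x_m}` such that `P = det(M)`. In this case, we say that `M` represents `P`."
(The size of `M` is arbitrary.) [cite: GrenetMonteilThomasse2013, Def. 1.1] -/
def Representable (P : MvPolynomial σ F) : Prop :=
  ∃ (N : ℕ) (M : Matrix (Fin N) (Fin N) (MvPolynomial σ F)),
    M.IsSymm ∧ HasScalarOrVarEntries M ∧ M.det = P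

/-- Entries in `F ∪ {x_v}` are affine linear forms (GMT p0003: "other definitions where … the
symmetric matrix has linear (degree-1) polynomials as entries … essentially equivalent").
[cite: GrenetMonteilThomasse2013, §1 (p0003, after Def. 1.1)] -/
theorem HasScalarOrVarEntries.totalDegree_le_one {ι : Type*} {M : Matrix ι ι (MvPolynomial σ F)}
    (h : HasScalarOrVarEntries M) (i j : ι) : (M i j).totalDegree ≤ 1 := by
  rcases h i j with ⟨c, hc⟩ | ⟨v, hv⟩
  · rw [hc, totalDegree_C]; exact zero_le_one
  · rw [hv, totalDegree_X]

/-- An SDR in GMT's sense (entries in `F ∪ {x_v}`) is in particular a symmetric AFFINE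
determinantal representation of the same size in the tree's sense
(`Literature.Computability.AlgebraicComplexity.HasSymmDetRepr`: symmetric matrix of affine linear
forms; GMT p0003: "The two definitions are essentially equivalent").
[cite: GrenetMonteilThomasse2013, §1 (p0003)] -/
theorem Representable.exists_hasSymmDetRepr {P : MvPolynomial σ F} (h : Representable P) :
    ∃ N, Literature.Computability.AlgebraicComplexity.HasSymmDetRepr P N := by
  obtain ⟨N, M, hs, he, hdet⟩ := h
  exact ⟨N, M, hs, fun i j => he.totalDegree_le_one i j, hdet⟩

variable [Fintype σ]

/-- **GMT13 Definition 4.1 (p0007), in its restated form.** "A polynomial `P` is factorizable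
modulo `R(ℓ)` if there exist some linear polynomials `L_1, …, L_k` of `F[x_1, …, x_m]` such that
`π_ℓ(P) = π_ℓ(L_1 ⋯ L_k)`", i.e. `P − L_1⋯L_k ∈ 𝓘(ℓ) = ⟨x_v² + ℓ_v⟩`. Rendered with the linear
polynomials `L_j = a_j + Σ_v b_{jv} x_v` and the ideal membership as explicit data
(`isLinFactorizableMod_iff` is the printed form). [cite: GrenetMonteilThomasse2013, Def. 4.1] -/
def IsLinFactorizableMod (ℓ : σ → F) (P : MvPolynomial σ F) : Prop :=
  ∃ (n : ℕ) (a : Fin n → F) (b : Fin n → σ → F) (q : σ → MvPolynomial σ F),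
    P = (∏ j, (C (a j) + ∑ v, C (b j v) * X v)) + ∑ v, q v * (X v ^ 2 + C (ℓ v))

omit [Fintype σ] in
/-- Affine substitutions preserve affine-ness: if `p` and all `g_v` have total degree `≤ 1`, so
does `p(g)`. [folklore] -/
private theorem totalDegree_aeval_le_one [Fintype σ] {τ : Type*} {R : Type*} [CommSemiring R]
    {p : MvPolynomial σ R} (hp : p.totalDegree ≤ 1) (g : σ → MvPolynomial τ R)
    (hg : ∀ v, (g v).totalDegree ≤ 1) : (MvPolynomial.aeval g p).totalDegree ≤ 1 := by
  classical
  rw [eq_C_add_sum_of_totalDegree_le_one hp, map_add, map_sum]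
  refine (totalDegree_add _ _).trans (max_le ?_ ?_)
  · rw [aeval_C, MvPolynomial.algebraMap_eq, totalDegree_C]; exact zero_le_one
  · refine (totalDegree_finsetSum _ _).trans (Finset.sup_le fun v _ => ?_)
    rw [map_mul, aeval_C, aeval_X, MvPolynomial.algebraMap_eq]
    refine (totalDegree_mul _ _).trans ?_
    rw [totalDegree_C, zero_add]
    exact hg v

/-- Affine polynomials have total degree `≤ 1`. [folklore] -/
private theorem totalDegree_affine_le_one (a : F) (b : σ → F) :
    (C a + ∑ v, C (b v) * X v : MvPolynomial σ F).totalDegree ≤ 1 := by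
  refine (totalDegree_add _ _).trans (max_le ?_ ?_)
  · rw [totalDegree_C]; exact zero_le_one
  · refine (totalDegree_finsetSum _ _).trans (Finset.sup_le fun v _ => ?_)
    refine (totalDegree_mul _ _).trans ?_
    rw [totalDegree_C, zero_add, totalDegree_X]

/-- The printed form of Definition 4.1: `P` is factorizable modulo `R(ℓ)` iff
`P − L_1 ⋯ L_k ∈ 𝓘(ℓ)` for some polynomials `L_j` of degree `≤ 1`.
[cite: GrenetMonteilThomasse2013, Def. 4.1] -/
theorem isLinFactorizableMod_iff [DecidableEq σ] (ℓ : σ → F) (P : MvPolynomial σ F) :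
    IsLinFactorizableMod ℓ P ↔ ∃ (n : ℕ) (L : Fin n → MvPolynomial σ F),
      (∀ j, (L j).totalDegree ≤ 1) ∧ P - ∏ j, L j ∈ sqIdeal F σ ℓ := by
  constructor
  · rintro ⟨n, a, b, q, h⟩
    refine ⟨n, fun j => C (a j) + ∑ v, C (b j v) * X v, fun j => totalDegree_affine_le_one _ _, ?_⟩
    rw [sqIdeal, Ideal.mem_span_range_iff_exists_fun]
    exact ⟨q, by rw [h]; ring⟩
  · rintro ⟨n, L, hL, hmem⟩
    obtain ⟨q, hq⟩ := Ideal.mem_span_range_iff_exists_fun.mp hmem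
    refine ⟨n, fun j => coeff 0 (L j), fun j v => coeff (Finsupp.single v 1) (L j), q, ?_⟩
    have hprod : ∏ j, (C (coeff 0 (L j)) + ∑ v, C (coeff (Finsupp.single v 1) (L j)) * X v) =
        ∏ j, L j :=
      Finset.prod_congr rfl fun j _ => (eq_C_add_sum_of_totalDegree_le_one (hL j)).symm
    rw [hprod, hq]
    ring

/-- **GMT13 Theorem 4.2 (p0007) at the tuple `ℓ² = 0̄`, for general symmetric matrices with an
affine diagonal.** If `P = det M` for a symmetric matrix `M` over `F[x]` (`char F = 2`) whose
DIAGONAL entries have degree `≤ 1` (off-diagonal entries arbitrary — GMT's gSDRs, Def. 3.4, and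
the tree's affine symmetric representations are covered), then `P` is factorizable modulo
`R(0̄)`: `P ≡ L_1 ⋯ L_k (mod ⟨x_v²⟩)` with the `L_j` of degree `≤ 1`. Proof as printed (§4.1,
p0007–p0009): project to `R(0̄)` (Lemma 4.4), make the off-diagonal entries constant (Lemma 4.5),
and run the elimination `elim` (Lemmas 4.6–4.8, induction on the dimension).
[cite: GrenetMonteilThomasse2013, Thm. 4.2] -/
theorem det_isLinFactorizableMod_zero [CharP F 2] [DecidableEq σ] {ι : Type*} [Fintype ι]
    [DecidableEq ι] (M : Matrix ι ι (MvPolynomial σ F)) (hM : M.IsSymm)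
    (hdiag : ∀ i, (M i i).totalDegree ≤ 1) : IsLinFactorizableMod (0 : σ → F) M.det := by
  haveI := charP_sqZero (F := F) (σ := σ)
  set π := Ideal.Quotient.mk (sqIdeal F σ 0) with hπ
  have hA : (M.map π).IsSymm := hM.map _
  -- Lemmas 4.4–4.5: project and normalise
  have h45 := det_eq_det_nf absZero mul_self_eq_absZero hA
  have hd : ∀ i, (M.map π) i i ∈ linElems (F := F) (σ := σ) := fun i => by
    rw [Matrix.map_apply]
    exact mk_mem_linElems_of_totalDegree_le_one (hdiag i)
  have hc : (Matrix.of fun i j => absZero ((M.map π) i j)).IsSymm :=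
    Matrix.IsSymm.ext fun i j => by rw [Matrix.of_apply, Matrix.of_apply, hA.apply i j]
  have hE := elim absZero mul_self_eq_absZero (linElems (F := F) (σ := σ)) one_mem_linElems
    (Fintype.card ι) ι rfl (fun i => (M.map π) i i) (Matrix.of fun i j => absZero ((M.map π) i j))
    hd hc
  obtain ⟨n, t, ht, hprod⟩ := hE
  choose a b hab using fun j => exists_affine_of_mem_linElems (ht j)
  have hmem : M.det - ∏ j, (C (a j) + ∑ v, C (b j v) * X v) ∈ sqIdeal F σ 0 := by
    rw [← Ideal.Quotient.eq_zero_iff_mem, map_sub, map_prod, sub_eq_zero, RingHom.map_det,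
      RingHom.mapMatrix_apply, h45, ← hprod]
    exact Finset.prod_congr rfl fun j _ => (hab j).symm
  obtain ⟨q, hq⟩ := Ideal.mem_span_range_iff_exists_fun.mp hmem
  exact ⟨n, a, b, q, by rw [hq]; ring⟩


/-- The shift `x_v ↦ x_v + ℓ_v` (an involutive `F`-algebra automorphism in characteristic `2`);
it carries `𝓘(ℓ²)` onto `𝓘(0̄)` since `(x + ℓ)² + ℓ² = x²`.
[folklore] -/
def shift (ℓ : σ → F) : MvPolynomial σ F →ₐ[F] MvPolynomial σ F :=
  MvPolynomial.aeval fun v => X v + C (ℓ v)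

omit [Fintype σ] in
/-- The shift on variables. [folklore] -/
@[simp] private theorem shift_X (ℓ : σ → F) (v : σ) : shift ℓ (X v) = X v + C (ℓ v) := by
  simp [shift]

omit [Fintype σ] in
/-- The shift on constants. [folklore] -/
@[simp] private theorem shift_C (ℓ : σ → F) (a : F) : shift ℓ (C a) = C a := by
  simp [shift]

omit [Fintype σ] in
/-- The shift is an involution in characteristic `2`. [folklore] -/
private theorem shift_shift [CharP F 2] (ℓ : σ → F) (p : MvPolynomial σ F) : shift ℓ (shift ℓ p)
    = p := by
  have h : (shift ℓ).comp (shift ℓ) = AlgHom.id F _ := by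
    refine MvPolynomial.algHom_ext fun v => ?_
    rw [AlgHom.comp_apply, shift_X, map_add, shift_X, shift_C, AlgHom.id_apply, add_assoc,
      CharTwo.add_self_eq_zero, add_zero]
  exact AlgHom.congr_fun h p

/-- **GMT13 Theorem 4.2 (p0007), all tuples of squares.** "Let `P ∈ F[x_1, …, x_m]` be a
representable polynomial. Then for every tuple of squares `ℓ² ∈ F^m`, `P` is factorizable modulo
`R(ℓ²)`." Stated for every symmetric matrix with an affine diagonal (as above); reduced to the
case `ℓ = 0̄` by the automorphism `x_v ↦ x_v + ℓ_v`, which maps `𝓘(ℓ²)` onto `𝓘(0̄)` in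
characteristic `2` (§5.1: "the possibility to factorize a polynomial modulo `𝓘(ℓ²)` does not
depend on `ℓ²`"). [cite: GrenetMonteilThomasse2013, Thm. 4.2] -/
theorem det_isLinFactorizableMod_sq [CharP F 2] [DecidableEq σ] {ι : Type*} [Fintype ι]
    [DecidableEq ι] (M : Matrix ι ι (MvPolynomial σ F)) (hM : M.IsSymm)
    (hdiag : ∀ i, (M i i).totalDegree ≤ 1) (ℓ : σ → F) :
    IsLinFactorizableMod (fun v => ℓ v ^ 2) M.det := by
  have hg : ∀ v, (X v + C (ℓ v) : MvPolynomial σ F).totalDegree ≤ 1 := fun v => by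
    refine (totalDegree_add _ _).trans (max_le ?_ ?_)
    · rw [totalDegree_X]
    · rw [totalDegree_C]; exact zero_le_one
  have hM' : (M.map (shift ℓ)).IsSymm := hM.map _
  have hdiag' : ∀ i, ((M.map (shift ℓ)) i i).totalDegree ≤ 1 := fun i =>
    totalDegree_aeval_le_one (hdiag i) (fun v => X v + C (ℓ v)) hg
  obtain ⟨n, a, b, q, h⟩ := det_isLinFactorizableMod_zero (M.map (shift ℓ)) hM' hdiag'
  have hMM : (M.map (shift ℓ)).map (shift ℓ) = M := by
    ext i j
    rw [Matrix.map_apply, Matrix.map_apply, shift_shift]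
  have key : M.det = shift ℓ (M.map (shift ℓ)).det := by
    rw [AlgHom.map_det, AlgHom.mapMatrix_apply, hMM]
  refine ⟨n, fun j => a j + ∑ v, b j v * ℓ v, b, fun v => shift ℓ (q v), ?_⟩
  rw [key, h, map_add, map_prod, map_sum]
  congr 1
  · refine Finset.prod_congr rfl fun j _ => ?_
    simp only [map_add, map_sum, map_mul, shift_C, shift_X, mul_add, Finset.sum_add_distrib]
    ring
  · refine Finset.sum_congr rfl fun v _ => ?_
    rw [map_mul, map_add, map_pow, shift_X, Pi.zero_apply, C_0, map_zero, add_zero,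
      add_pow_char, ← map_pow]

/-- **GMT13 Theorem 4.2 as printed (p0007).** A representable polynomial (Def. 1.1) is
factorizable modulo `R(ℓ²)` for every tuple of squares `ℓ²`.
[cite: GrenetMonteilThomasse2013, Thm. 4.2] -/
theorem Representable.isLinFactorizableMod_sq [CharP F 2] [DecidableEq σ] {P : MvPolynomial σ F}
    (h : Representable P) (ℓ : σ → F) : IsLinFactorizableMod (fun v => ℓ v ^ 2) P := by
  obtain ⟨N, M, hs, he, rfl⟩ := h
  exact det_isLinFactorizableMod_sq M hs (fun i => he.totalDegree_le_one i i) ℓ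

/-- The same for the tree's symmetric affine determinantal representations of any size.
[cite: GrenetMonteilThomasse2013, Thm. 4.2] -/
theorem isLinFactorizableMod_sq_of_hasSymmDetRepr [CharP F 2] [DecidableEq σ]
    {P : MvPolynomial σ F} {N : ℕ}
    (h : Literature.Computability.AlgebraicComplexity.HasSymmDetRepr P N) (ℓ : σ → F) :
    IsLinFactorizableMod (fun v => ℓ v ^ 2) P := by
  obtain ⟨M, hs, hdeg, rfl⟩ := h
  exact det_isLinFactorizableMod_sq M hs (fun i => hdeg i i) ℓ

end Statements

/-! ## §3: some representable polynomials (Lemma 3.1; the example of §1) and §6 (Theorem 6.1, ⇒) -/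

section RepresentableExamples

variable {F : Type*} [Field F] {σ : Type*}

/-- **GMT13 Lemma 3.1 (p0005).** "Let `P` and `Q` be two representable polynomials. Then `P × Q`
is representable." Printed proof: the block-diagonal matrix (disjoint union of the two graphs).
[cite: GrenetMonteilThomasse2013, Lemma 3.1] -/
theorem Representable.mul {P Q : MvPolynomial σ F} (hP : Representable P) (hQ : Representable Q) :
    Representable (P * Q) := by
  obtain ⟨m, M, hMs, hMe, hMdet⟩ := hP
  obtain ⟨n, N, hNs, hNe, hNdet⟩ := hQ
  let e : Fin m ⊕ Fin n ≃ Fin (m + n) := finSumFinEquiv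
  let B : Matrix (Fin m ⊕ Fin n) (Fin m ⊕ Fin n) (MvPolynomial σ F) := Matrix.fromBlocks M 0 0 N
  have hBs : B.IsSymm := Matrix.IsSymm.fromBlocks hMs (by simp) hNs
  have hBe : HasScalarOrVarEntries B := by
    rintro (i | i) (j | j)
    · exact hMe i j
    · exact Or.inl ⟨0, by simp [B]⟩
    · exact Or.inl ⟨0, by simp [B]⟩
    · exact hNe i j
  refine ⟨m + n, Matrix.reindex e e B, hBs.submatrix _, fun i j => hBe (e.symm i) (e.symm j), ?_⟩
  rw [Matrix.det_reindex_self, Matrix.det_fromBlocks_zero₂₁, hMdet, hNdet]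

/-- **GMT13 §1, the example after Definition 1.1 (p0003).** "the polynomial `xy + yz + zx` is
representable as the determinant of the `4 × 4` matrix
`[[x,0,0,1],[0,y,0,1],[0,0,z,1],[1,1,1,0]]`" (in characteristic `2`; over a general field that
determinant is `−(xy + yz + zx)`). Non-vacuity of `Representable`.
[cite: GrenetMonteilThomasse2013, §1 (p0003)] -/
theorem representable_example [CharP F 2] :
    Representable (X 0 * X 1 + X 1 * X 2 + X 2 * X 0 : MvPolynomial (Fin 3) F) := by
  let M : Matrix (Fin 4) (Fin 4) (MvPolynomial (Fin 3) F) :=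
    !![X 0, 0, 0, 1; 0, X 1, 0, 1; 0, 0, X 2, 1; 1, 1, 1, 0]
  refine ⟨4, M, ?_, ?_, ?_⟩
  · exact Matrix.IsSymm.ext fun i j => by fin_cases i <;> fin_cases j <;> rfl
  · intro i j
    fin_cases i <;> fin_cases j <;>
      first
      | exact Or.inr ⟨_, rfl⟩
      | exact Or.inl ⟨0, by rw [C_0]; rfl⟩
      | exact Or.inl ⟨1, by rw [C_1]; rfl⟩
  · have h : M.det = -(X 0 * X 1 + X 1 * X 2 + X 2 * X 0) := by
      rw [Matrix.det_succ_row_zero]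
      simp [M, Fin.sum_univ_succ, Matrix.det_fin_three, Matrix.submatrix_apply, Fin.succAbove]
      ring
    rw [h, CharTwo.neg_eq]

/-- **GMT13 Theorem 6.1 (p0014), direction (⇒), over any field.** "`P` can be written as the
determinant of an alternating matrix [skew-symmetric with zero diagonal] with entries in
`F ∪ {x_1, …, x_m}` [only if] `P` is a square": indeed `det M = Pf(M)²` for every alternating
matrix over the commutative ring `F[x]` (Lang, *Algebra*, XV §9) — the tree's Cayley theorem
`Literature.LinearAlgebra.Matrix.det_eq_pfaffian_sq`, whatever the entries are. The converse
direction (⇐, via Valiant's universality of the determinant) is not typed here.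
[cite: GrenetMonteilThomasse2013, Thm. 6.1 (⇒)] -/
theorem isSquare_det_of_alternating {R : Type*} [CommRing R] {n : ℕ}
    (M : Matrix (Fin n) (Fin n) (MvPolynomial σ R)) (hM : Mᵀ = -M) (hd : ∀ i, M i i = 0) :
    IsSquare M.det :=
  ⟨Literature.LinearAlgebra.Matrix.pfaffian M, by
    rw [Literature.LinearAlgebra.Matrix.det_eq_pfaffian_sq M hM hd, pow_two]⟩

end RepresentableExamples

/-! ## §4.2: `xy + z` has no SDR — over every field of characteristic 2 -/

section Example

variable {F : Type*} [Field F]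

/-- Square-free coefficients do not see the ideal `𝓘(0̄)`-part. [folklore] -/
private theorem coeff_sq_terms {σ : Type*} [Fintype σ] (q : σ → MvPolynomial σ F) (m : σ →₀ ℕ)
    (hm : ∀ v, m v ≤ 1) : coeff m (∑ v, q v * (X v ^ 2 + C ((0 : σ → F) v))) = 0 := by
  rw [coeff_sum]
  refine Finset.sum_eq_zero fun v _ => ?_
  rw [Pi.zero_apply, C_0, add_zero, X_pow_eq_monomial, coeff_mul_monomial', if_neg]
  rw [Finsupp.single_le_iff]
  have := hm v
  omega

/-- Constant coefficient of an affine polynomial. [folklore] -/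
private theorem coeff_zero_affine {σ : Type*} [Fintype σ] (a : F) (b : σ → F) :
    coeff 0 (C a + ∑ v, C (b v) * X v) = a := by
  simp only [coeff_add, coeff_zero_C, coeff_sum, coeff_C_mul, coeff_zero_X, mul_zero,
    Finset.sum_const_zero, add_zero]

/-- Degree-one coefficients of an affine polynomial. [folklore] -/
private theorem coeff_single_affine {σ : Type*} [Fintype σ] [DecidableEq σ] (a : F) (b : σ → F)
    (w : σ) : coeff (Finsupp.single w 1) (C a + ∑ v, C (b v) * X v) = b w := by
  have h0 : ¬ (0 : σ →₀ ℕ) = Finsupp.single w 1 := fun h => by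
    simpa using (DFunLike.congr_fun h w).symm
  simp only [coeff_add, coeff_C, if_neg h0, coeff_sum, coeff_C_mul, coeff_X, zero_add,
    Finsupp.single_left_inj one_ne_zero, mul_ite, mul_one, mul_zero, Finset.sum_ite_eq',
    Finset.mem_univ, if_true]

/-- Degree-one coefficients of a product (Leibniz rule for `∂/∂x_v` at the origin). [folklore] -/
private theorem coeff_single_mul {σ : Type*} (v : σ) (p r : MvPolynomial σ F) :
    coeff (Finsupp.single v 1) (p * r) =
      coeff 0 p * coeff (Finsupp.single v 1) r + coeff (Finsupp.single v 1) p * coeff 0 r := by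
  have key : ∀ s : MvPolynomial σ F, coeff (Finsupp.single v 1) s = coeff 0 (pderiv v s) :=
    fun s => by simp [coeff_pderiv]
  have c0 : ∀ s : MvPolynomial σ F, coeff 0 s = constantCoeff s := fun s => rfl
  rw [key (p * r), Derivation.leibniz, coeff_add, smul_eq_mul, smul_eq_mul, c0 (p * pderiv v r),
    c0 (r * pderiv v p), map_mul, map_mul, ← c0, ← c0, ← c0, ← c0, ← key, ← key]
  ring

/-- **GMT13 §4.2 (p0009), over every field of characteristic `2` (indeed over every field).**
`xy + z` is NOT factorizable modulo `R(0̄)`. The printed example is over `𝔽₂` with the tuple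
`(1,1,1)` and a machine count ("`R(1,1,1)` has 256 elements, 136 of which can be written as the
product of linear polynomials … `π(xy+z)` is [not] one of those"); here the tuple `0̄` and the
paper's own argument of Lemmas 5.2–5.3 (§5.1, p0011): if `xy + z ≡ L_1 ⋯ L_k (mod ⟨x², y², z²⟩)`
then exactly one `L_j` has no constant term (constant and degree-one coefficients), that `L_j` is
a multiple of `z` (coefficients of `x` and `y`), so every monomial of `L_1 ⋯ L_k` is divisible by
`z` — contradicting the coefficient of `xy`.
[cite: GrenetMonteilThomasse2013, §4.2 and Lemmas 5.2–5.3] -/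
theorem not_isLinFactorizableMod_zero_X_mul_X_add_X :
    ¬ IsLinFactorizableMod (0 : Fin 3 → F) (X 0 * X 1 + X 2 : MvPolynomial (Fin 3) F) := by
  classical
  rintro ⟨n, a, b, q, h⟩
  set L : Fin n → MvPolynomial (Fin 3) F := fun j => C (a j) + ∑ v, C (b j v) * X v with hL
  have hQ : ∀ m : Fin 3 →₀ ℕ, (∀ v, m v ≤ 1) →
      coeff m (∑ v, q v * (X v ^ 2 + C ((0 : Fin 3 → F) v))) = 0 := coeff_sq_terms q
  -- the monomials of `P = xy + z`
  set e0 : Fin 3 →₀ ℕ := Finsupp.single 0 1 with he0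
  set e1 : Fin 3 →₀ ℕ := Finsupp.single 1 1 with he1
  set e2 : Fin 3 →₀ ℕ := Finsupp.single 2 1 with he2
  have hPm : (X 0 * X 1 + X 2 : MvPolynomial (Fin 3) F) = monomial (e0 + e1) 1 + monomial e2 1 := by
    simp only [X, monomial_mul, mul_one, he0, he1, he2]
  have hval : ∀ m : Fin 3 →₀ ℕ, coeff m (X 0 * X 1 + X 2 : MvPolynomial (Fin 3) F) =
      (if e0 + e1 = m then 1 else 0) + (if e2 = m then 1 else 0) := fun m => by
    rw [hPm, coeff_add, coeff_monomial, coeff_monomial]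
  -- (in)equalities between these monomials, decided at one coordinate each
  have d01_0 : e0 + e1 ≠ 0 := fun h' => by simpa [he0, he1] using DFunLike.congr_fun h' 0
  have d2_0 : e2 ≠ 0 := fun h' => by simpa [he2] using DFunLike.congr_fun h' 2
  have d01_e0 : e0 + e1 ≠ e0 := fun h' => by simpa [he0, he1] using DFunLike.congr_fun h' 1
  have d2_e0 : e2 ≠ e0 := fun h' => by simpa [he0, he2] using DFunLike.congr_fun h' 2
  have d01_e1 : e0 + e1 ≠ e1 := fun h' => by simpa [he0, he1] using DFunLike.congr_fun h' 0
  have d2_e1 : e2 ≠ e1 := fun h' => by simpa [he1, he2] using DFunLike.congr_fun h' 2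
  have d01_e2 : e0 + e1 ≠ e2 := fun h' => by simpa [he0, he1, he2] using DFunLike.congr_fun h' 0
  have d2_e01 : e2 ≠ e0 + e1 := fun h' => d01_e2 h'.symm
  have sq0 : ∀ v, (0 : Fin 3 →₀ ℕ) v ≤ 1 := fun v => by simp
  have sq1 : ∀ (w v : Fin 3), (Finsupp.single w 1 : Fin 3 →₀ ℕ) v ≤ 1 := fun w v => by
    rw [Finsupp.single_apply]; split_ifs <;> simp
  have sq01 : ∀ v, (e0 + e1) v ≤ 1 := fun v => by
    fin_cases v <;> simp [he0, he1]
  -- constant coefficients: some `L_{j₀}` has no constant term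
  have c0 : ∀ s : MvPolynomial (Fin 3) F, coeff 0 s = constantCoeff s := fun s => rfl
  have hprod0 : coeff 0 (∏ j, L j) = ∏ j, a j := by
    rw [c0, map_prod]
    exact Finset.prod_congr rfl fun j _ => by rw [← c0]; exact coeff_zero_affine _ _
  have E0 := congrArg (coeff 0) h
  rw [hval, if_neg d01_0, if_neg d2_0, add_zero, coeff_add, hQ 0 sq0, add_zero, hprod0] at E0
  obtain ⟨j₀, -, hj₀⟩ := Finset.prod_eq_zero_iff.mp E0.symm
  -- split off `L_{j₀}`; degree-one coefficients of the product
  set U := ∏ j ∈ Finset.univ.erase j₀, L j with hU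
  have hsplit : ∏ j, L j = L j₀ * U := (Finset.mul_prod_erase _ _ (Finset.mem_univ j₀)).symm
  have hdeg1 : ∀ v, coeff (Finsupp.single v 1) (∏ j, L j) = b j₀ v * coeff 0 U := by
    intro v
    rw [hsplit, coeff_single_mul, coeff_zero_affine, hj₀, zero_mul, zero_add, coeff_single_affine]
  have E2 := congrArg (coeff e2) h
  rw [hval, if_neg d01_e2, if_pos rfl, zero_add, coeff_add, hQ e2 (sq1 2), add_zero, he2,
    hdeg1] at E2
  have Ex := congrArg (coeff e0) h
  rw [hval, if_neg d01_e0, if_neg d2_e0, add_zero, coeff_add, hQ e0 (sq1 0), add_zero, he0,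
    hdeg1] at Ex
  have Ey := congrArg (coeff e1) h
  rw [hval, if_neg d01_e1, if_neg d2_e1, add_zero, coeff_add, hQ e1 (sq1 1), add_zero, he1,
    hdeg1] at Ey
  have hu : coeff 0 U ≠ 0 := fun h0 => by
    rw [h0, mul_zero] at E2
    exact one_ne_zero E2
  have hb0 : b j₀ 0 = 0 := (mul_eq_zero.mp Ex.symm).resolve_right hu
  have hb1 : b j₀ 1 = 0 := (mul_eq_zero.mp Ey.symm).resolve_right hu
  -- so `L_{j₀} = b · z`, and every monomial of the product is divisible by `z`
  have hLj : L j₀ = X 2 * C (b j₀ 2) := by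
    simp only [hL]
    rw [Fin.sum_univ_three, hj₀, hb0, hb1, C_0, zero_mul, zero_mul, zero_add, zero_add, zero_add,
      mul_comm]
  have Exy := congrArg (coeff (e0 + e1)) h
  rw [hval, if_pos rfl, if_neg d2_e01, add_zero, coeff_add, hQ _ sq01, add_zero, hsplit, hLj,
    mul_assoc, coeff_X_mul', if_neg] at Exy
  · exact one_ne_zero Exy
  · simp [he0, he1, Finsupp.mem_support_iff]

/-- Hence **`xy + z` has no symmetric affine determinantal representation of any size over a
field of characteristic `2`** (tree vocabulary `HasSymmDetRepr`: symmetric matrices of affine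
linear forms — a fortiori none with entries in `F ∪ {x, y, z}`). GKKP 2011 §1.1: "For fields of
characteristic `2`, it can be shown that some polynomials (such as e.g. the polynomial `xy + z`)
cannot be represented as determinants of symmetric matrices [GMT]".
[cite: GrenetMonteilThomasse2013, §4.2 with Thm. 4.2; GrenetEtAl2011, §1.1] -/
theorem not_hasSymmDetRepr_X_mul_X_add_X [CharP F 2] (N : ℕ) :
    ¬ Literature.Computability.AlgebraicComplexity.HasSymmDetRepr
      (X 0 * X 1 + X 2 : MvPolynomial (Fin 3) F) N := by
  rintro ⟨M, hMs, hdeg, hdet⟩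
  have h := det_isLinFactorizableMod_zero M hMs (fun i => hdeg i i)
  rw [hdet] at h
  exact not_isLinFactorizableMod_zero_X_mul_X_add_X h

/-- **GMT13 §4.2 (p0009) for every field of characteristic `2`.** "the polynomial `xy + z` can not
be represented as the determinant of a symmetric matrix with entries in `𝔽₂ ∪ {x, y, z}`" — and
the same over any field of characteristic `2` (GKKP 2011 §1.1; the authors "conjectured that these
representations do not always exist in characteristic `2`. We prove this fact in this paper",
GMT p0003). [cite: GrenetMonteilThomasse2013, §4.2] -/
theorem not_representable_X_mul_X_add_X [CharP F 2] :
    ¬ Representable (X 0 * X 1 + X 2 : MvPolynomial (Fin 3) F) := fun h => by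
  obtain ⟨N, hN⟩ := h.exists_hasSymmDetRepr
  exact not_hasSymmDetRepr_X_mul_X_add_X N hN

/-- So `sdc(xy + z)` takes the junk value `0` over fields of characteristic `2` (no symmetric
representation of any size; cf. the docstring of `symmDeterminantalComplexity`).
[cite: GrenetMonteilThomasse2013, §4.2] -/
theorem symmDeterminantalComplexity_X_mul_X_add_X [CharP F 2] :
    Literature.Computability.AlgebraicComplexity.symmDeterminantalComplexity
      (X 0 * X 1 + X 2 : MvPolynomial (Fin 3) F) = 0 :=
  (Literature.Computability.AlgebraicComplexity.symmDeterminantalComplexity_eq_zero_iff _).2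
    (Or.inr (not_hasSymmDetRepr_X_mul_X_add_X (F := F)))

end Example

/-! ## GKKP 2011 §1.1: the `2 × 2` permanent `xw + yz` cannot be symmetrized in characteristic 2 -/

section Permanent

open Literature.Computability.AlgebraicComplexity

variable {F : Type*} [Field F]

/-- Symmetric affine representations are stable under affine substitutions of the variables
(substitute into every entry). [folklore] -/
private theorem hasSymmDetRepr_aeval_of_affine {σ τ : Type*} [Fintype σ] {f : MvPolynomial σ F}
    {N : ℕ}
    (h : HasSymmDetRepr f N) (g : σ → MvPolynomial τ F) (hg : ∀ v, (g v).totalDegree ≤ 1) :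
    HasSymmDetRepr (MvPolynomial.aeval g f) N := by
  obtain ⟨A, hAs, hdeg, hdet⟩ := h
  refine ⟨A.map (MvPolynomial.aeval g), hAs.map _, fun i j => ?_, ?_⟩
  · rw [Matrix.map_apply]
    exact totalDegree_aeval_le_one (hdeg i j) g hg
  · rw [← AlgHom.mapMatrix_apply, ← AlgHom.map_det, hdet]

/-- `PER_2 = x₀₀ x₁₁ + x₀₁ x₁₀` (over any commutative ring). [folklore] -/
private theorem perPoly_fin_two (k : Type*) [CommRing k] :
    perPoly (Fin 2) k = X (0, 0) * X (1, 1) + X (0, 1) * X (1, 0) := by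
  have huniv : (Finset.univ : Finset (Equiv.Perm (Fin 2))) = {1, Equiv.swap 0 1} := by decide
  rw [perPoly, Matrix.permanent, huniv, Finset.sum_pair (by decide), Fin.prod_univ_two,
    Fin.prod_univ_two]
  simp [Matrix.mvPolynomialX_apply, Equiv.swap_apply_left, Equiv.swap_apply_right]
  ring

/-- The substitution `x₀₀ ↦ x, x₁₁ ↦ y, x₀₁ ↦ z, x₁₀ ↦ 1` takes `PER_2` to `xy + z`. [folklore] -/
private def perTwoSubst : Fin 2 × Fin 2 → MvPolynomial (Fin 3) F :=
  fun p => !![X 0, X 2; 1, X 1] p.1 p.2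

/-- The substitution takes `PER_2` to `xy + z`. [folklore] -/
private theorem aeval_perTwoSubst_perPoly :
    MvPolynomial.aeval (perTwoSubst (F := F)) (perPoly (Fin 2) F) = X 0 * X 1 + X 2 := by
  rw [perPoly_fin_two, map_add, map_mul, map_mul, aeval_X, aeval_X, aeval_X, aeval_X]
  simp [perTwoSubst]

/-- The substitution is affine. [folklore] -/
private theorem totalDegree_perTwoSubst_le (p : Fin 2 × Fin 2) :
    (perTwoSubst (F := F) p).totalDegree ≤ 1 := by
  obtain ⟨i, j⟩ := p
  fin_cases i <;> fin_cases j <;> simp [perTwoSubst, totalDegree_X]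

/-- **GKKP 2011 §1.1, via [GMT]: "the 2-dimensional permanent `xw + yz` cannot be 'symmetrized'
over characteristic `2` with any dimension".** Over a field of characteristic `2`, `PER_2` has no
symmetric affine determinantal representation of any size: substituting `w ↦ 1` would give one
for `x·1 + yz`, i.e. for `xy + z`. [cite: GrenetEtAl2011, §1.1; GrenetMonteilThomasse2013, §4.2] -/
theorem not_hasSymmDetRepr_perPoly_two [CharP F 2] (N : ℕ) :
    ¬ HasSymmDetRepr (perPoly (Fin 2) F) N := fun h =>
  not_hasSymmDetRepr_X_mul_X_add_X N (by
    simpa only [aeval_perTwoSubst_perPoly] using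
      hasSymmDetRepr_aeval_of_affine h perTwoSubst totalDegree_perTwoSubst_le)

/-- Hence `sdc(PER_2) = 0` (junk value: no symmetric representation of any size) over fields of
characteristic `2` — the example named in the docstring of `symmDeterminantalComplexity`.
[cite: GrenetEtAl2011, §1.1] -/
theorem symmDeterminantalComplexity_perPoly_two [CharP F 2] :
    symmDeterminantalComplexity (perPoly (Fin 2) F) = 0 :=
  (symmDeterminantalComplexity_eq_zero_iff _).2 (Or.inr (not_hasSymmDetRepr_perPoly_two (F := F)))

/-- In particular no `GMT`-style SDR (entries in `F ∪ {x_ij}`) of `PER_2` exists in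
characteristic `2`. [cite: GrenetEtAl2011, §1.1] -/
theorem not_representable_perPoly_two [CharP F 2] : ¬ Representable (perPoly (Fin 2) F) :=
    fun h => by
  obtain ⟨N, hN⟩ := h.exists_hasSymmDetRepr
  exact not_hasSymmDetRepr_perPoly_two N hN

end Permanent

/-! ## GMT13 Theorem 6.1, direction (⇐), for affine entries -/

section AlternatingConverse

open Literature.Computability.AlgebraicComplexity

variable {R : Type*} [CommRing R] {σ : Type*}

/-- The block matrix `J = [[0, 1], [-1, 0]]` is a product of three unitriangular block matrices,
hence `det [[0, N], [-Nᵀ, 0]] = det [[N, 0], [0, Nᵀ]] · det J = (det N)²`. [folklore] -/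
private theorem det_fromBlocks_zero_neg_transpose_zero {m : Type*} [Fintype m] [DecidableEq m]
    {S : Type*} [CommRing S] (N : Matrix m m S) :
    (Matrix.fromBlocks 0 N (-Nᵀ) 0).det = N.det * N.det := by
  have hJ : (Matrix.fromBlocks (0 : Matrix m m S) (1 : Matrix m m S) (-1 : Matrix m m S)
      (0 : Matrix m m S)) =
      Matrix.fromBlocks (1 : Matrix m m S) (1 : Matrix m m S) (0 : Matrix m m S)
          (1 : Matrix m m S) *
        Matrix.fromBlocks (1 : Matrix m m S) (0 : Matrix m m S) (-1 : Matrix m m S)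
          (1 : Matrix m m S) *
        Matrix.fromBlocks (1 : Matrix m m S) (1 : Matrix m m S) (0 : Matrix m m S)
          (1 : Matrix m m S) := by
    rw [Matrix.fromBlocks_multiply, Matrix.fromBlocks_multiply]
    simp
  have hM : Matrix.fromBlocks 0 N (-Nᵀ) 0 =
      Matrix.fromBlocks N 0 0 Nᵀ * Matrix.fromBlocks (0 : Matrix m m S) (1 : Matrix m m S)
        (-1 : Matrix m m S) (0 : Matrix m m S) := by
    rw [Matrix.fromBlocks_multiply]
    simp
  rw [hM, Matrix.det_mul, hJ]
  simp [Matrix.det_fromBlocks_zero₂₁, Matrix.det_transpose]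

/-- **GMT13 Theorem 6.1 (p0014), direction (⇐), in the affine-entries reading** (GMT p0003:
matrices of degree-`1` polynomials, "essentially equivalent"). "Conversely, let `P = Q²` … there
exists a square matrix `N` with entries in `F ∪ {x_1,…,x_m}` such that `det(N) = Q` [Valiant
1979]. The matrix `M = [[0, N], [-Nᵀ, 0]]` is alternate and satisfies `det(M) = det(N)² = Q² =
P`." Here `N` is the tree's affine universality of the determinant
(`exists_hasDetRepr_holds`, [cite: ValiantSTOC1979, Thm. 1]), so `M` has affine entries; valid
over every commutative ring of coefficients. [cite: GrenetMonteilThomasse2013, Thm. 6.1 (⇐)] -/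
theorem exists_alternating_affine_det_eq_of_isSquare {P : MvPolynomial σ R} (hP : IsSquare P) :
    ∃ (n : ℕ) (M : Matrix (Fin n) (Fin n) (MvPolynomial σ R)),
      Mᵀ = -M ∧ (∀ i, M i i = 0) ∧ (∀ i j, (M i j).totalDegree ≤ 1) ∧ M.det = P := by
  obtain ⟨Q, rfl⟩ := hP
  obtain ⟨m, N, hNdeg, hNdet⟩ := exists_hasDetRepr_holds (k := R) (σ := σ) Q
  let e : Fin m ⊕ Fin m ≃ Fin (m + m) := finSumFinEquiv
  let B : Matrix (Fin m ⊕ Fin m) (Fin m ⊕ Fin m) (MvPolynomial σ R) :=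
    Matrix.fromBlocks 0 N (-Nᵀ) 0
  refine ⟨m + m, Matrix.reindex e e B, ?_, ?_, ?_, ?_⟩
  · simp only [B, Matrix.reindex_apply, Matrix.transpose_submatrix, Matrix.fromBlocks_transpose,
      Matrix.transpose_zero, Matrix.transpose_neg, Matrix.transpose_transpose]
    rw [show (Matrix.fromBlocks 0 (-N) Nᵀ 0 : Matrix _ _ (MvPolynomial σ R)) =
        -Matrix.fromBlocks 0 N (-Nᵀ) 0 by rw [Matrix.fromBlocks_neg, neg_zero, neg_neg]]
    rfl
  · intro i
    rw [Matrix.reindex_apply, Matrix.submatrix_apply]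
    rcases e.symm i with j | j <;> simp [B]
  · intro i j
    rw [Matrix.reindex_apply, Matrix.submatrix_apply]
    rcases e.symm i with a | a <;> rcases e.symm j with b | b
    · simp [B]
    · simpa [B] using hNdeg a b
    · simp only [B, Matrix.fromBlocks_apply₂₁, Matrix.neg_apply, Matrix.transpose_apply,
        totalDegree_neg]
      exact hNdeg b a
    · simp [B]
  · rw [Matrix.det_reindex_self, det_fromBlocks_zero_neg_transpose_zero, hNdet]

end AlternatingConverse

/-! ## Corollary: in characteristic 2 neither `DET_n` nor `PER_n` (`n ≥ 2`) can be symmetrized -/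

section DetPer

open Literature.Computability.AlgebraicComplexity

variable {F : Type*} [Field F]

/-- `f = det A` for an affine `n × n` matrix `A` exhibits `f` as the affine substitution
`x_{ij} ↦ A_{ij}` of `DET_n`. [folklore] -/
private theorem aeval_entries_detPoly {σ : Type*} {n : ℕ}
    (A : Matrix (Fin n) (Fin n) (MvPolynomial σ F)) :
    MvPolynomial.aeval (fun p : Fin n × Fin n => A p.1 p.2) (detPoly (Fin n) F) = A.det := by
  rw [detPoly, AlgHom.map_det, AlgHom.mapMatrix_apply]
  congr 1
  ext i j
  simp [Matrix.mvPolynomialX_apply]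

/-- `xy + z = det [[x, -z], [1, y]]`: an affine determinantal representation of size `2`.
[folklore] -/
private theorem hasDetRepr_X_mul_X_add_X_two :
    HasDetRepr (X 0 * X 1 + X 2 : MvPolynomial (Fin 3) F) 2 := by
  refine ⟨!![X 0, -X 2; 1, X 1], fun i j => ?_, ?_⟩
  · fin_cases i <;> fin_cases j <;> simp [totalDegree_X, totalDegree_neg]
  · rw [Matrix.det_fin_two_of]
    ring

/-- **Corollary (assembled in the tree from GKKP 2011 §1.1's remark via [GMT]).** Over a field of
characteristic `2`, the generic determinant `DET_n`, `n ≥ 2`, has NO symmetric affine determinantal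
representation of any size: a symmetric representation of `DET_n` would, by the universality
substitution `x_{ij} ↦ A_{ij}` (for `xy + z = det A`, `A` affine of size `2 ≤ n`), give one of
`xy + z`, contradicting `not_hasSymmDetRepr_X_mul_X_add_X` (GMT13 §4.2). GKKP §1.1 print the case
`n = 2` ("the 2-dimensional permanent `xw + yz`" `= DET_2` in characteristic `2`); the tree's
`symmDeterminantalComplexity (detPoly (Fin n) F)` therefore takes its junk value `0` for every
`n ≥ 2` in characteristic `2`. [cite: GrenetEtAl2011, §1.1; GrenetMonteilThomasse2013, §4.2] -/
theorem not_hasSymmDetRepr_detPoly [CharP F 2] {n : ℕ} (hn : 2 ≤ n) (N : ℕ) :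
    ¬ HasSymmDetRepr (detPoly (Fin n) F) N := by
  intro h
  obtain ⟨A, hAdeg, hAdet⟩ := HasDetRepr.mono_holds (hasDetRepr_X_mul_X_add_X_two (F := F)) hn
  have h' := hasSymmDetRepr_aeval_of_affine h (fun p : Fin n × Fin n => A p.1 p.2)
    (fun p => hAdeg p.1 p.2)
  rw [aeval_entries_detPoly, hAdet] at h'
  exact not_hasSymmDetRepr_X_mul_X_add_X N h'

/-- The same for the generic permanent `PER_n = DET_n` (`n ≥ 2`) in characteristic `2`
(the tree's `perPoly_eq_detPoly_of_charP_two`); `n = 2` is GKKP 2011 §1.1's printed sentence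
(`not_hasSymmDetRepr_perPoly_two`). [cite: GrenetEtAl2011, §1.1] -/
theorem not_hasSymmDetRepr_perPoly [CharP F 2] {n : ℕ} (hn : 2 ≤ n) (N : ℕ) :
    ¬ HasSymmDetRepr (perPoly (Fin n) F) N := by
  rw [perPoly_eq_detPoly_of_charP_two]
  exact not_hasSymmDetRepr_detPoly hn N

/-- Hence `sdc(DET_n) = 0` (junk value) for `n ≥ 2` over fields of characteristic `2`.
[cite: GrenetEtAl2011, §1.1] -/
theorem symmDeterminantalComplexity_detPoly [CharP F 2] {n : ℕ} (hn : 2 ≤ n) :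
    symmDeterminantalComplexity (detPoly (Fin n) F) = 0 :=
  (symmDeterminantalComplexity_eq_zero_iff _).2 (Or.inr (not_hasSymmDetRepr_detPoly hn))

/-- And `sdc(PER_n) = 0` (junk value) for `n ≥ 2` over fields of characteristic `2`.
[cite: GrenetEtAl2011, §1.1] -/
theorem symmDeterminantalComplexity_perPoly [CharP F 2] {n : ℕ} (hn : 2 ≤ n) :
    symmDeterminantalComplexity (perPoly (Fin n) F) = 0 :=
  (symmDeterminantalComplexity_eq_zero_iff _).2 (Or.inr (not_hasSymmDetRepr_perPoly hn))

end DetPer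

end GMT2013

end Literature.Barriers.ValiantsHypothesis
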